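import Literature.Topology.FourManifolds.DehnNielsenBaerMeridianOrbit
import Literature.Topology.FourManifolds.DehnNielsenBaerReflectionAction
import Literature.Topology.FourManifolds.SurfaceGroupTransvection
import HarnessLib

/-!
# Dehn–Nielsen–Baer on the flower surface: the meridian Dehn twist acts on the marking by the
# handle transvection `b₀ ↦ b₀ a₀^{±1}`

Topic `Literature/Topology/FourManifolds`; PROOF file of the named fact
`Literature.Topology.FourManifolds.DehnNielsenBaerSurfaceSmooth` (`DehnNielsenBaerSurface.lean`), item W2.3-meridian of
the `π₁`-bookkeeping for the residue `dehnNielsenBaerSurfaceSmooth_of_flower_generators_symm`: the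
Dehn twist `T` of `∂V_g` about the meridian `m₀` (`DehnNielsenBaerFlowerMeridianTwist.exists_meridianDehnTwist`,
a based diffeomorphism) acts on the melon marking `ν : S_g ≃* π₁(∂V_g, x₀)`
(`DehnNielsenBaerMarkingActions.marking`) by `SurfaceGroup.transvEquiv 0 e`, `e = ±1`:

  `T_# (ν x) = ν (transvEquiv 0 e x)`,  `b₀ ↦ b₀ a₀ᵉ`, all other generators fixed.

Proof.  §1: planar separation — a point of the surface with `x > r_a` and `-ε < y < 0`,
`ε ≤ r_a sin(π/g)`, has angle in `(-π/g, 0)`, hence lies in the open standard wedge and in no other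
slice.  §2: the `y`-coordinate along the explicit marking loops (`γ`, `ℓ_a` have `y ≥ 0`/`y = 0`, the
lens edges `Ldn`/`Lup` have `y ≤ 0`/`y ≥ 0`).  §3: `ℓ_b` as three edge pieces (head = the lower lens
edge from `P` down to radius `r₁`, middle, tail).  §4: along the head a sector self-map of the form
`θ(λ(y), ·)` with `λ` rising from `0` (far end) to the period `T₀` (at `P`) satisfies, by the square
lemma (`VanKampen.homotopicWithin_of_square`), `[TS ∘ ℓ_b] = [ℓ]⁻¹ · [ℓ_b]`, `ℓ(u) = θ(u T₀, P)`
(`mk_map_loopR_true`).  §5: transport to the pole along `γ` (`mapOfEq_pathConj_fromPath`): a sector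
self-map fixing `γ`, `ℓ_a` pointwise fixes `θ(a)`, and with `[ℓ] = [ℓ_a]^{±1}` sends `θ(b)` to
`θ(b) θ(a)^e`.  §6: self-maps of `Z_g` and their restrictions to the sector/slices on `π₁`
(`restrictZ`, `onZ T = boundaryHomeomorph ∘ T ∘ boundaryHomeomorph⁻¹`).  §7: orbits of an
`H`-preserving flow at small height `|y|` never cross `x = r_a` (`q_g(r_a, y) > c_g`, intermediate
value theorem); the flow chart at `P` (inverse function theorem).  §8: the meridian twist `T` of
`exists_meridianDehnTwist` with the minimal period `T₀` (`DehnNielsenBaerMeridianOrbit.exists_meridianOrbit`)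
and a collar width `ε ≤ min(ε₁, r_a sin(π/g), η₀)`: it moves only points of the flow family with
`-ε < y < 0`, and these (and their images) have `x > r_a`; so `onZ T` preserves the standard sector,
fixes the slices `1, …, g-1`, `γ`, `ℓ_a`, and twists `ℓ_b` as in §4 (head points lie in the flow
family by the chart at `P`; the rest of the lower lens edge has `y ≤ -ε` or `x ≤ r_a`); the orbit
loop reads `ℓ_a^{±1}`.  §9: assembly on the generators (`PresentedGroup.ext`, `marking_of'`).

Everything is proved; the only new definitions are the explicit paths/maps `eHead`, `eMid`, `eTail`,
`orbLoop`, `twHead`, `restrictZ`, `onZ`; no named facts (D-0026).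

## References

* B. Farb, D. Margalit, *A primer on mapping class groups*, PMS 49 (2012), §3.1.1, Prop. 3.2,
  Thm. 4.1, Thm. 8.1. [FarbMargalit2012]
* H. Zieschang, E. Vogt, H.-D. Coldewey, *Surfaces and planar discontinuous groups*, LNM 835 (1980),
  §3.2, Thm. 5.6.1–5.6.2. [ZieschangVogtColdewey1980]
* W. Magnus, A. Karrass, D. Solitar, *Combinatorial Group Theory* (1966), §3.7 Table 3.1.
  [MagnusKarrassSolitar1966]
* A. Hatcher, *Algebraic Topology* (2002), Prop. 1.5, Example 1.22. [HatcherAT2002]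
* J. M. Lee, *Introduction to Smooth Manifolds*, 2nd ed. (2013), Thm. 9.22 (flow box / inverse
  function theorem for flows). [LeeSmoothManifolds2013]
-/

open scoped Manifold ContDiff Topology Real unitInterval
open Set Function Filter Metric

noncomputable section

namespace Literature.Topology.FourManifolds

open PlanarThickening PlanarDouble Literature.Geometry.Manifold Literature.AlgebraicTopology.FundamentalGroup
  Literature.AlgebraicTopology.FundamentalGroup.EdgePath
  Literature.AlgebraicTopology.FundamentalGroup.BasePointTransfer PlanarLevelTwist

/-- Local notation: `𝔼 n` is the model Euclidean space `EuclideanSpace ℝ (Fin n)`. -/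
local notation "𝔼 " n:arg => EuclideanSpace ℝ (Fin n)

namespace FlowerModel

variable {g : ℕ}

/-! ### §1 Planar separation: thin points below the positive `x`-axis lie in the open standard wedge -/

/-- Polar coordinates: `(pol r θ)_x = r cos θ`. [folklore] -/
theorem pol_apply_zero (r θ : ℝ) : pol r θ 0 = r * Real.cos θ := by
  rw [pol, toC_symm_apply_zero, Complex.re_ofReal_mul, Complex.exp_ofReal_mul_I_re]

/-- Polar coordinates: `(pol r θ)_y = r sin θ`. [folklore] -/
theorem pol_apply_one (r θ : ℝ) : pol r θ 1 = r * Real.sin θ := by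
  rw [pol, toC_symm_apply_one, Complex.im_ofReal_mul, Complex.exp_ofReal_mul_I_im]

/-- `0 < π/g ≤ π/2` for `g ≥ 2`. [folklore] -/
theorem pi_div_le_pi_div_two (hg : 2 ≤ g) : π / g ≤ π / 2 :=
  div_le_div_of_nonneg_left Real.pi_pos.le two_pos (by exact_mod_cast hg)

/-- A coordinate is bounded by the Euclidean norm. [folklore] -/
theorem apply_le_norm₂ (u : 𝔼 2) (i : Fin 2) : u i ≤ ‖u‖ :=
  (le_abs_self _).trans (by simpa using PiLp.norm_apply_le u i)

/-- **The angle of a thin point below the positive `x`-axis**: if `x > r_a`, `-ε < y < 0` and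
`ε ≤ r_a sin(π/g)` then the standard angle lies in `(-π/g, 0)`. [folklore] -/
theorem ang_mem_Ioo_of_coord (hg : 2 ≤ g) {ε : ℝ} (hε : ε ≤ ra hg * Real.sin (π / g)) {u : 𝔼 2}
    (hx : ra hg < u 0) (hy : u 1 ∈ Ioo (-ε) 0) : ang 0 u ∈ Ioo (-(π / g)) 0 := by
  set r := ‖u‖ with hr
  set α := ang 0 u with hα
  have hpol : pol r α = u := pol_norm_ang 0 u
  have hra := ra_pos hg
  have hrr : ra hg < r := lt_of_lt_of_le hx (apply_le_norm₂ u 0)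
  have hr0 : 0 < r := hra.trans hrr
  have hx' : u 0 = r * Real.cos α := by conv_lhs => rw [← hpol]; exact pol_apply_zero r α
  have hy' : u 1 = r * Real.sin α := by conv_lhs => rw [← hpol]; exact pol_apply_one r α
  have hαmem : α ∈ Ioc (0 - π) (0 + π) := ang_mem 0 u
  have hπg : 0 < π / g := div_pos Real.pi_pos (by exact_mod_cast (show 0 < g by omega))
  have hπg2 := pi_div_le_pi_div_two hg
  -- `sin α < 0`, hence `α < 0`
  have hsin : Real.sin α < 0 := by
    by_contra h; push Not at h
    have : 0 ≤ u 1 := by rw [hy']; exact mul_nonneg hr0.le h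
    linarith [hy.2]
  have hα0 : α < 0 := by
    by_contra h; push Not at h
    exact absurd (Real.sin_nonneg_of_nonneg_of_le_pi h (by linarith [hαmem.2])) (not_le.2 hsin)
  -- `cos α > 0`, hence `α > -π/2`
  have hcos : 0 < Real.cos α := by
    by_contra h; push Not at h
    have : u 0 ≤ 0 := by rw [hx']; exact mul_nonpos_of_nonneg_of_nonpos hr0.le h
    linarith
  have hαpi : -(π / 2) < α := by
    by_contra h; push Not at h
    have h1 : Real.cos (-α) ≤ 0 :=
      Real.cos_nonpos_of_pi_div_two_le_of_le (by linarith) (by linarith [hαmem.1])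
    rw [Real.cos_neg] at h1
    linarith
  -- `sin α > -sin (π/g) = sin (-π/g)`, hence `α > -π/g`
  have hsg : 0 < Real.sin (π / g) := Real.sin_pos_of_pos_of_lt_pi hπg (by linarith [Real.pi_pos])
  have hsin2 : Real.sin (-(π / g)) < Real.sin α := by
    rw [Real.sin_neg]
    have h1 : -ε < r * Real.sin α := hy' ▸ hy.1
    have h2 : ra hg * Real.sin (π / g) < r * Real.sin (π / g) := mul_lt_mul_of_pos_right hrr hsg
    by_contra h; push Not at h
    have : r * Real.sin α ≤ r * -Real.sin (π / g) := mul_le_mul_of_nonneg_left h hr0.le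
    linarith
  refine ⟨?_, hα0⟩
  exact (Real.strictMonoOn_sin.lt_iff_lt ⟨by linarith, by linarith⟩ ⟨hαpi.le, by linarith⟩).1 hsin2

/-- **A point with standard angle in `(-π/g, 0)` lies in none of the wedges `1, …, g-1`.**
[folklore] -/
theorem not_mem_secW_of_ang (hg : 2 ≤ g) {k : ℕ} (hk1 : 1 ≤ k) (hkg : k + 1 ≤ g) {u : 𝔼 2}
    (hu : u ≠ 0) (hα : ang 0 u ∈ Ioo (-(π / g)) 0) : u ∉ secW g k := by
  rintro ⟨-, hβ⟩
  set α := ang 0 u with hαdef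
  have hG : (0 : ℝ) < g := by exact_mod_cast (show 0 < g by omega)
  have hK : (1 : ℝ) ≤ k := by exact_mod_cast hk1
  have hKG : (k : ℝ) + 1 ≤ g := by exact_mod_cast hkg
  have hπ := Real.pi_pos
  have hπg : 0 < π / g := div_pos hπ hG
  have hνk : νk g k = -(2 * k * π / g) := rfl
  -- `2π/g ≤ 2kπ/g ≤ 2π - 2π/g`
  have hlo : 2 * (π / g) ≤ 2 * k * π / g := by
    rw [mul_div_assoc', div_le_div_iff_of_pos_right hG]; nlinarith
  have hhi : 2 * k * π / g + 2 * (π / g) ≤ 2 * π := by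
    rw [mul_div_assoc' 2 π, ← add_div, div_le_iff₀ hG]; nlinarith
  by_cases hcase : α + 2 * k * π / g ≤ π
  · -- the frames `0` and `ν_k` give the same angle
    have heq : ang (νk g k) u = α :=
      ang_eq_of_mem hu (by rw [hνk]; exact ⟨by linarith [hα.1], by linarith⟩)
    have h2 := hβ.2
    rw [heq, hνk] at h2
    linarith [hα.1]
  · push Not at hcase
    have heq : ang (νk g k + 2 * π) u = α :=
      ang_eq_of_mem hu (by rw [hνk]; exact ⟨by linarith, by linarith [hα.2]⟩)
    rw [ang_add_two_pi] at heq
    have h1 := hβ.1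
    have h5 : ang (νk g k) u = α - 2 * π := by linarith
    rw [h5, hνk] at h1
    -- `α ≥ 2π - (2k+1)π/g ≥ π/g > 0`
    have h4 : 2 * k * π / g = 2 * k * (π / g) := by ring
    rw [h4] at h1 hhi
    nlinarith [hα.2]

/-- A point of the flower domain with standard angle in `(-π/g, 0)` lies in the standard wedge.
[folklore] -/
theorem mem_wedge_of_ang {u : 𝔼 2} (hq : flower g u ≤ level g) (hα : ang 0 u ∈ Ioo (-(π / g)) 0) :
    u ∈ wedge g := by
  refine ⟨hq, ?_⟩
  rw [← ang_zero_left, abs_le]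
  exact ⟨hα.1.le, hα.2.le.trans (by positivity)⟩

/-- **Thin surface points below the positive `x`-axis lie in the standard sector.** [folklore] -/
theorem mem_sectorZ_of_coord (hg : 2 ≤ g) {ε : ℝ} (hε : ε ≤ ra hg * Real.sin (π / g)) {p : 𝔼 3}
    (hp : p ∈ flowerSurface g) (hx : ra hg < p 0) (hy : p 1 ∈ Ioo (-ε) 0) : p ∈ sectorZ g := by
  refine ⟨hp, mem_wedge_of_ang (apply_proj_le_of_mem hp) ?_⟩
  exact ang_mem_Ioo_of_coord hg hε (by simpa using hx) (by simpa using hy)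

/-- **Thin surface points below the positive `x`-axis lie in none of the slices `1, …, g-1`.**
[folklore] -/
theorem not_mem_secS_of_coord (hg : 2 ≤ g) {ε : ℝ} (hε : ε ≤ ra hg * Real.sin (π / g)) {p : 𝔼 3}
    (hx : ra hg < p 0) (hy : p 1 ∈ Ioo (-ε) 0) {k : ℕ} (hk1 : 1 ≤ k) (hkg : k + 1 ≤ g) :
    p ∉ secS g k := by
  rw [secS_eq hg]
  rintro ⟨-, hw⟩
  have h0 : proj p ≠ 0 := fun h => by
    have : proj p 0 = 0 := by rw [h]; rfl
    rw [proj_apply_zero] at this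
    linarith [ra_pos hg]
  exact not_mem_secW_of_ang hg hk1 hkg h0
    (ang_mem_Ioo_of_coord hg hε (by simpa using hx) (by simpa using hy)) hw

/-! ### §2 The `y`-coordinate along the explicit loops -/

/-- The lens edges: `(Ldn r)_y = -r sin θ_lo(r)` for `r ≥ 0`. [folklore] -/
theorem Ldn_apply_one {r : ℝ} (hr : 0 ≤ r) : Ldn g r 1 = -(r * Real.sin (thlo g r)) := by
  rw [Ldn_of_nonneg hr, lift_apply_one, pol_apply_one, Real.sin_neg, mul_neg]

/-- The lens edges: `(Ldn r)_x = r cos θ_lo(r)` for `r ≥ 0`. [folklore] -/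
theorem Ldn_apply_zero {r : ℝ} (hr : 0 ≤ r) : Ldn g r 0 = r * Real.cos (thlo g r) := by
  rw [Ldn_of_nonneg hr, lift_apply_zero, pol_apply_zero, Real.cos_neg]

/-- The lens edges: `(Lup r)_y = r sin θ_lo(r)` for `r ≥ 0`. [folklore] -/
theorem Lup_apply_one {r : ℝ} (hr : 0 ≤ r) : Lup g r 1 = r * Real.sin (thlo g r) := by
  rw [Lup_of_nonneg hr, lift_apply_one, pol_apply_one]

/-- **The lower lens edge lies in `y ≤ 0`.** [folklore] -/
theorem Ldn_apply_one_nonpos (hg : 2 ≤ g) {r : ℝ} (hr : 0 ≤ r) : Ldn g r 1 ≤ 0 := by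
  rw [Ldn_apply_one hr, neg_nonpos]; exact mul_nonneg hr (sin_thlo_nonneg (by omega) r)

/-- **The upper lens edge lies in `y ≥ 0`.** [folklore] -/
theorem Lup_apply_one_nonneg (hg : 2 ≤ g) {r : ℝ} (hr : 0 ≤ r) : 0 ≤ Lup g r 1 := by
  rw [Lup_apply_one hr]; exact mul_nonneg hr (sin_thlo_nonneg (by omega) r)

/-- The lower lens edge has `x ≤ r`. [folklore] -/
theorem Ldn_apply_zero_le {r : ℝ} (hr : 0 ≤ r) : Ldn g r 0 ≤ r := by
  rw [Ldn_apply_zero hr]; exact mul_le_of_le_one_right hr (Real.cos_le_one _)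

/-- **Strictly inside the lens range the lower lens edge is strictly below the axis.** [folklore] -/
theorem Ldn_apply_one_neg (hg : 2 ≤ g) {r : ℝ} (h1 : rho1 hg < r) (h2 : r < rt g 7) : Ldn g r 1 < 0 := by
  have hr : 0 < r := (rho1_pos hg).trans h1
  rw [Ldn_apply_one hr.le, neg_lt_zero]
  refine mul_pos hr (Real.sin_pos_of_pos_of_lt_pi (thlo_pos_of_mem_lens hg h1 h2) ?_)
  exact (thlo_le (by omega) r).trans_lt ((pi_div_le_pi_div_two hg).trans_lt (by linarith [Real.pi_pos]))

/-- The `C₁` edges lie in the plane `y = 0`. [folklore] -/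
theorem Cup_apply_one (r : ℝ) : Cup g r 1 = 0 := by simp [Cup, upperPt]

/-- The `C₁` edges lie in the plane `y = 0`. [folklore] -/
theorem Cdn_apply_one (r : ℝ) : Cdn g r 1 = 0 := by simp [Cdn, lowerPt]

/-- A path parametrised through an edge takes its values on that edge. [folklore] -/
theorem mem_image_of_isParamOn {X : Type*} [TopologicalSpace X] {E : ℝ → X} {J : Set ℝ} {a b : X}
    {p : Path a b} {u v : ℝ} (h : IsParamOn E J p u v) (t : I) : p t ∈ E '' J := by
  obtain ⟨φ, -, -, -, hJ, hp⟩ := h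
  exact ⟨φ t, hJ t, (hp t).symm⟩

/-- **The access path `γ` lies in `y ≥ 0`** (valley ray at angle `π/g`, then the circle
`r = 7^{1/20g}` through angles `[0, π/g]`). [folklore] -/
theorem gam_apply_one_nonneg (hg : 2 ≤ g) (t : I) : 0 ≤ gam hg t 1 := by
  have hg1 : 1 ≤ g := by omega
  have hπg : 0 ≤ π / g := by positivity
  have hsin : 0 ≤ Real.sin (π / g) :=
    Real.sin_nonneg_of_nonneg_of_le_pi hπg ((pi_div_le_pi_div_two hg).trans (by linarith [Real.pi_pos]))
  refine VanKampen.trans_mem (S := {x : 𝔼 3 | 0 ≤ x 1}) (fun s => ?_) (fun s => ?_) t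
  · show 0 ≤ wPath hg s 1
    have hs : 0 + (rt g 7 - 0) * (s : ℝ) ∈ Icc 0 (rt g 7) := by
      refine ⟨by nlinarith [s.2.1, rt_pos (g := g) (by norm_num : (0:ℝ) < 7)], ?_⟩
      nlinarith [s.2.2, rt_pos (g := g) (by norm_num : (0:ℝ) < 7)]
    rw [wPath_apply, vArcFun_of_le hg (hs.2.trans (rt_seven_lt_rho4 hg).le)]
    simp only [PiLp.add_apply, lift_apply_one, PiLp.smul_apply, ez_apply_one, smul_eq_mul, mul_zero, add_zero]
    rw [pol_apply_one]
    exact mul_nonneg hs.1 hsin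
  · show 0 ≤ merid hg s 1
    rw [merid_apply, upperPt]
    simp only [PiLp.add_apply, lift_apply_one, PiLp.smul_apply, ez_apply_one, smul_eq_mul, mul_zero, add_zero]
    rw [pol_apply_one]
    refine mul_nonneg (rt_pos (by norm_num)).le (Real.sin_nonneg_of_nonneg_of_le_pi ?_ ?_)
    · exact mul_nonneg (by linarith [s.2.2]) hπg
    · calc (1 - (s : ℝ)) * (π / g) ≤ 1 * (π / g) := by
            exact mul_le_mul_of_nonneg_right (by linarith [s.2.1]) hπg
        _ ≤ π := by rw [one_mul]; exact (pi_div_le_pi_div_two hg).trans (by linarith [Real.pi_pos])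

/-- **The loop `ℓ_a` lies in the plane `y = 0`.** [folklore] -/
theorem loopR_false_apply_one (hg : 2 ≤ g) (t : I) : loopR hg (0, false) t 1 = 0 := by
  have hCdn : ∀ {a b : 𝔼 3} {p : Path a b} {u v : ℝ}, IsParamOn (CdnC g) (JC hg) p u v → ∀ s, p s 1 = 0 :=
    fun h s => by obtain ⟨r, -, hr⟩ := mem_image_of_isParamOn h s; rw [← hr, CdnC_apply, Cdn_apply_one]
  have hCup : ∀ {a b : 𝔼 3} {p : Path a b} {u v : ℝ}, IsParamOn (CupC g) (JC hg) p u v → ∀ s, p s 1 = 0 :=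
    fun h s => by obtain ⟨r, -, hr⟩ := mem_image_of_isParamOn h s; rw [← hr, CupC_apply, Cup_apply_one]
  have e : loopR hg (0, false) = ((apprPlus hg (0, false)).trans ((hIn.map (arcs hg (0, false)).continuous).trans
      (hOut.map (arcs hg (0, false)).continuous))).trans (apprMinus hg (0, false)).symm := by
    rw [loopR, hh, Path.map_trans]
  rw [e]
  refine VanKampen.trans_mem (S := {x : 𝔼 3 | x 1 = 0}) (VanKampen.trans_mem (hCdn (isParamOn_apprPlus_a hg))
    (VanKampen.trans_mem (hCdn (isParamOn_hIn_a hg)) (hCup (isParamOn_hOut_a hg))))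
    (VanKampen.symm_mem (hCup (isParamOn_apprMinus_a hg))) t

/-- The tail of the loop `ℓ_b` (second half of the lens arc, then back to `P`) lies in `y ≥ 0`.
[folklore] -/
theorem loopR_true_tail_apply_one_nonneg (hg : 2 ≤ g) (t : I) :
    0 ≤ ((hOut.map (arcs hg (0, true)).continuous).trans (apprMinus hg (0, true)).symm) t 1 := by
  have hLup : ∀ {a b : 𝔼 3} {p : Path a b} {u v : ℝ}, IsParamOn (LupC hg) (JL hg) p u v → ∀ s, 0 ≤ p s 1 :=
    fun h s => by
      obtain ⟨r, hr, hr'⟩ := mem_image_of_isParamOn h s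
      rw [← hr', LupC_apply]
      exact Lup_apply_one_nonneg hg ((rho1_pos hg).le.trans hr.1)
  exact VanKampen.trans_mem (S := {x : 𝔼 3 | 0 ≤ x 1}) (hLup (isParamOn_hOut_b hg))
    (VanKampen.symm_mem (hLup (isParamOn_apprMinus_b hg))) t

/-! ### §3 The loop `ℓ_b` as three edge pieces -/

/-- `P` lies in the plane `y = 0`. [folklore] -/
theorem ptP_apply_one (g : ℕ) : ptP g 1 = 0 := by simp [ptP]

/-- **The head of `ℓ_b`**: the lower lens edge from `P` (`r = 7^{1/20g}`) to radius `r₁`. [folklore] -/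
def eHead (hg : 2 ≤ g) (r₁ : ℝ) : Path (ptP g) (Ldn g r₁) :=
  (epath (LdnC hg) (rt g 7) r₁).cast (Ldn_rt_seven hg).symm rfl

/-- **The middle of `ℓ_b`**: the lower lens edge from radius `r₁` to the pinch point `I`. [folklore] -/
def eMid (hg : 2 ≤ g) (r₁ : ℝ) : Path (Ldn g r₁) (ptI hg) :=
  (epath (LdnC hg) r₁ (rho1 hg)).cast rfl (Ldn_rho1 hg).symm

/-- **The tail of `ℓ_b`**: the upper lens edge from `I` back to `P`. [folklore] -/
def eTail (hg : 2 ≤ g) : Path (ptI hg) (ptP g) :=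
  (epath (LupC hg) (rho1 hg) (rt g 7)).cast (Lup_rho1 hg).symm (Lup_rt_seven hg).symm

/-- `eHead`, evaluated. [folklore] -/
theorem eHead_apply (hg : 2 ≤ g) (r₁ : ℝ) (t : I) : eHead hg r₁ t = Ldn g (rt g 7 + (r₁ - rt g 7) * t) := rfl

/-- `eMid`, evaluated. [folklore] -/
theorem eMid_apply (hg : 2 ≤ g) (r₁ : ℝ) (t : I) : eMid hg r₁ t = Ldn g (r₁ + (rho1 hg - r₁) * t) := rfl

/-- `eTail`, evaluated. [folklore] -/
theorem eTail_apply (hg : 2 ≤ g) (t : I) : eTail hg t = Lup g (rho1 hg + (rt g 7 - rho1 hg) * t) := rfl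

section Pieces

variable (hg : 2 ≤ g) {r₁ : ℝ} (hr₁ : rho1 hg < r₁) (hr₁' : r₁ < rt g 7)
include hr₁ hr₁'

/-- `r₁ ∈ JL`. [folklore] -/
theorem r₁_mem_JL : r₁ ∈ JL hg := ⟨hr₁.le, hr₁'.le⟩

/-- The head is an `Ldn`-piece from `7^{1/20g}` to `r₁`. [folklore] -/
theorem isParamOn_eHead : IsParamOn (LdnC hg) (JL hg) (eHead hg r₁) (rt g 7) r₁ :=
  (isParamOn_epath (LdnC hg) (convex_JL hg) (rt_seven_mem_JL hg) (r₁_mem_JL hg hr₁ hr₁')).cast _ _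

/-- The middle is an `Ldn`-piece from `r₁` to `ρ₁`. [folklore] -/
theorem isParamOn_eMid : IsParamOn (LdnC hg) (JL hg) (eMid hg r₁) r₁ (rho1 hg) :=
  (isParamOn_epath (LdnC hg) (convex_JL hg) (r₁_mem_JL hg hr₁ hr₁') (rho1_mem_JL hg)).cast _ _

omit hr₁ hr₁' in
/-- The tail is an `Lup`-piece from `ρ₁` to `7^{1/20g}`. [folklore] -/
theorem isParamOn_eTail : IsParamOn (LupC hg) (JL hg) (eTail hg) (rho1 hg) (rt g 7) :=
  (isParamOn_epath (LupC hg) (convex_JL hg) (rho1_mem_JL hg) (rt_seven_mem_JL hg)).cast _ _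

omit hr₁ hr₁' in
/-- A path parametrised through `Ldn` over `JL` lies in the sector. [folklore] -/
theorem mem_of_isParamOn_Ldn {a b : 𝔼 3} {p : Path a b} {u v : ℝ} (h : IsParamOn (LdnC hg) (JL hg) p u v) (t : I) :
    p t ∈ sectorZ g := by
  obtain ⟨r, hr, hr'⟩ := mem_image_of_isParamOn h t
  rw [← hr']; exact mapsTo_Ldn hg hr

omit hr₁ hr₁' in
/-- A path parametrised through `Lup` over `JL` lies in the sector. [folklore] -/
theorem mem_of_isParamOn_Lup {a b : 𝔼 3} {p : Path a b} {u v : ℝ} (h : IsParamOn (LupC hg) (JL hg) p u v) (t : I) :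
    p t ∈ sectorZ g := by
  obtain ⟨r, hr, hr'⟩ := mem_image_of_isParamOn h t
  rw [← hr']; exact mapsTo_Lup hg hr

omit hr₁ in
/-- The head parameter lies in `[r₁, 7^{1/20g}]`. [folklore] -/
theorem head_param_mem (t : I) : rt g 7 + (r₁ - rt g 7) * t ∈ Icc r₁ (rt g 7) :=
  ⟨by nlinarith [t.2.2], by nlinarith [t.2.1]⟩

omit hr₁' in
/-- The middle parameter lies in `[ρ₁, r₁]`. [folklore] -/
theorem mid_param_mem (t : I) : r₁ + (rho1 hg - r₁) * t ∈ Icc (rho1 hg) r₁ :=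
  ⟨by nlinarith [t.2.2], by nlinarith [t.2.1]⟩

omit hr₁ hr₁' in
/-- The tail parameter lies in `JL`. [folklore] -/
theorem tail_param_mem (t : I) : rho1 hg + (rt g 7 - rho1 hg) * t ∈ JL hg :=
  ⟨by nlinarith [t.2.1, rho1_lt_rt_seven hg], by nlinarith [t.2.2, rho1_lt_rt_seven hg]⟩

/-- **`ℓ_b` as three edge pieces**: in the homotopy quotient of the sector,
`[ℓ_b] = [eHead · eMid · eTail]`. [folklore] -/
theorem cl_loopR_true_eq_pieces
    (hL : ∀ t, (((eHead hg r₁).trans (eMid hg r₁)).trans (eTail hg)) t ∈ sectorZ g) :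
    cl (loopR hg (0, true)) (loopR_mem_sectorZ hg (0, true)) =
      cl (((eHead hg r₁).trans (eMid hg r₁)).trans (eTail hg)) hL := by
  have hη := (isParamOn_apprPlus_b hg).trans (isParamOn_hIn_b hg)
  have hτ := (isParamOn_hOut_b hg).trans (isParamOn_apprMinus_b hg).symm
  have h12par := (isParamOn_eHead hg hr₁ hr₁').trans (isParamOn_eMid hg hr₁ hr₁')
  have h12mem : ∀ t, ((eHead hg r₁).trans (eMid hg r₁)) t ∈ sectorZ g := mem_of_isParamOn_Ldn hg h12par
  have h3mem : ∀ t, eTail hg t ∈ sectorZ g := mem_of_isParamOn_Lup hg (isParamOn_eTail hg)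
  have hI : arcs hg (0, true) ctr = ptI hg := by rw [(isParamOn_hIn_b hg).target_eq, LdnC_apply, Ldn_rho1]
  rw [cl_loopR_split]
  conv_rhs => rw [cl_trans_split]
  rw [cl_eq_cast_of_isParamOn (LdnC hg) (convex_JL hg) (mapsTo_Ldn hg) _ hη _ h12mem h12par rfl hI,
    cl_eq_cast_of_isParamOn (LupC hg) (convex_JL hg) (mapsTo_Lup hg) _ hτ _ h3mem (isParamOn_eTail hg) hI rfl]
  simp only [cast_trans_cast, cast_eq_self]

end Pieces

/-! ### §4 The twisted loop `T ∘ ℓ_b ≃ ℓ⁻¹ · ℓ_b` in the sector -/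

/-- **The orbit loop** `u ↦ θ(u T₀, P)` at the lens tip. [cite: FarbMargalit2012, §3.1.1] -/
def orbLoop (θ : ℝ × 𝔼 3 → 𝔼 3) (T₀ : ℝ) (hθc : Continuous θ) (h0 : ∀ x, θ (0, x) = x)
    (hT₀ : θ (T₀, ptP g) = ptP g) : Path (ptP g) (ptP g) where
  toFun u := θ ((u : ℝ) * T₀, ptP g)
  continuous_toFun := hθc.comp ((continuous_subtype_val.mul continuous_const).prodMk continuous_const)
  source' := by simp [h0]
  target' := by simp [hT₀]

/-- `orbLoop`, evaluated. [folklore] -/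
theorem orbLoop_apply {θ : ℝ × 𝔼 3 → 𝔼 3} {T₀ : ℝ} (hθc : Continuous θ) (h0 : ∀ x, θ (0, x) = x)
    (hT₀ : θ (T₀, ptP g) = ptP g) (u : I) : orbLoop θ T₀ hθc h0 hT₀ u = θ ((u : ℝ) * T₀, ptP g) := rfl

/-- The orbit loop is parametrised through `u ↦ θ(u T₀, P)` over `[0, 1]`. [folklore] -/
theorem isParamOn_orbLoop {θ : ℝ × 𝔼 3 → 𝔼 3} {T₀ : ℝ} (hθc : Continuous θ) (h0 : ∀ x, θ (0, x) = x)
    (hT₀ : θ (T₀, ptP g) = ptP g) :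
    IsParamOn (fun u : ℝ => θ (u * T₀, ptP g)) (Icc 0 1) (orbLoop θ T₀ hθc h0 hT₀) 0 1 :=
  isParamOn_of_forall (fun u => (u : ℝ)) continuous_subtype_val (fun u => u.2) (fun _ => rfl) rfl rfl

/-- **The twisted head** `t ↦ θ(λ(y), ·)` along `eHead`. [cite: FarbMargalit2012, §3.1.1] -/
def twHead (hg : 2 ≤ g) (r₁ : ℝ) (θ : ℝ × 𝔼 3 → 𝔼 3) (lam : ℝ → ℝ) {T₀ : ℝ} (hθc : Continuous θ)
    (h0 : ∀ x, θ (0, x) = x) (hlam : Continuous lam) (hlam₁ : lam (Ldn g r₁ 1) = 0) (hlam0 : lam 0 = T₀)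
    (hT₀ : θ (T₀, ptP g) = ptP g) : Path (ptP g) (Ldn g r₁) where
  toFun t := θ (lam (eHead hg r₁ t 1), eHead hg r₁ t)
  continuous_toFun := hθc.comp ((hlam.comp ((EuclideanSpace.proj (1 : Fin 3)).continuous.comp
    (eHead hg r₁).continuous)).prodMk (eHead hg r₁).continuous)
  source' := by rw [(eHead hg r₁).source, ptP_apply_one, hlam0, hT₀]
  target' := by rw [(eHead hg r₁).target, hlam₁, h0]

/-- `twHead`, evaluated. [folklore] -/
theorem twHead_apply (hg : 2 ≤ g) (r₁ : ℝ) {θ : ℝ × 𝔼 3 → 𝔼 3} {lam : ℝ → ℝ} {T₀ : ℝ} (hθc : Continuous θ)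
    (h0 : ∀ x, θ (0, x) = x) (hlam : Continuous lam) (hlam₁ : lam (Ldn g r₁ 1) = 0) (hlam0 : lam 0 = T₀)
    (hT₀ : θ (T₀, ptP g) = ptP g) (t : I) :
    twHead hg r₁ θ lam hθc h0 hlam hlam₁ hlam0 hT₀ t = θ (lam (eHead hg r₁ t 1), eHead hg r₁ t) := rfl

/-- **The square lemma for the twisted head**: `[twHead] = [ℓ]⁻¹ · [eHead]` in the homotopy
quotient of the sector, via the two-parameter family `θ(s λ(y(t)), eHead⁻¹(t))`.
[cite: FarbMargalit2012, §3.1.1 and Prop. 3.2] -/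
theorem cl_twHead (hg : 2 ≤ g) {r₁ : ℝ} (hr₁' : r₁ < rt g 7)
    {θ : ℝ × 𝔼 3 → 𝔼 3} {lam : ℝ → ℝ} {T₀ : ℝ} (hθc : Continuous θ)
    (h0 : ∀ x, θ (0, x) = x) (hlam : Continuous lam) (hlam₁ : lam (Ldn g r₁ 1) = 0) (hlam0 : lam 0 = T₀)
    (hT₀ : θ (T₀, ptP g) = ptP g)
    (horb : ∀ r ∈ Icc r₁ (rt g 7), ∀ s ∈ Icc (0 : ℝ) 1, θ (s * lam (Ldn g r 1), Ldn g r) ∈ sectorZ g)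
    (hw : ∀ t, twHead hg r₁ θ lam hθc h0 hlam hlam₁ hlam0 hT₀ t ∈ sectorZ g)
    (hℓ : ∀ t, orbLoop θ T₀ hθc h0 hT₀ t ∈ sectorZ g) (hh : ∀ t, eHead hg r₁ t ∈ sectorZ g) :
    cl (twHead hg r₁ θ lam hθc h0 hlam hlam₁ hlam0 hT₀) hw =
      (cl (orbLoop θ T₀ hθc h0 hT₀) hℓ).symm.trans (cl (eHead hg r₁) hh) := by
  set w := twHead hg r₁ θ lam hθc h0 hlam hlam₁ hlam0 hT₀ with hwdef
  set ℓ := orbLoop θ T₀ hθc h0 hT₀ with hℓdef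
  -- the two-parameter family
  set G : C(I × I, 𝔼 3) := ⟨fun x => θ ((x.1 : ℝ) * lam ((eHead hg r₁).symm x.2 1), (eHead hg r₁).symm x.2),
    hθc.comp (((continuous_subtype_val.comp continuous_fst).mul (hlam.comp
      ((EuclideanSpace.proj (1 : Fin 3)).continuous.comp ((eHead hg r₁).symm.continuous.comp continuous_snd)))).prodMk
      ((eHead hg r₁).symm.continuous.comp continuous_snd))⟩ with hGdef
  have hGapply : ∀ x : I × I, G x = θ ((x.1 : ℝ) * lam ((eHead hg r₁).symm x.2 1), (eHead hg r₁).symm x.2) :=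
    fun _ => rfl
  have hG : ∀ x, G x ∈ sectorZ g := by
    rintro ⟨s, t⟩
    rw [hGapply]
    show θ ((s : ℝ) * lam (eHead hg r₁ (σ t) 1), eHead hg r₁ (σ t)) ∈ sectorZ g
    rw [eHead_apply]
    exact horb _ (head_param_mem hr₁' _) _ ⟨s.2.1, s.2.2⟩
  have hsq := VanKampen.homotopicWithin_of_square G hG (eHead hg r₁).symm ℓ (Path.refl (Ldn g r₁)) w.symm
    (fun u => by rw [hGapply]; simp [h0])
    (fun s => by
      rw [hGapply, hℓdef, orbLoop_apply, (eHead hg r₁).symm.target, ptP_apply_one, hlam0])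
    (fun s => by
      rw [hGapply, (eHead hg r₁).symm.source, hlam₁, mul_zero, h0, Path.refl_apply])
    (fun u => by
      rw [hGapply]
      show w (σ u) = θ (((1 : I) : ℝ) * lam (eHead hg r₁ (σ u) 1), eHead hg r₁ (σ u))
      rw [Set.Icc.coe_one, one_mul]
      rfl)
  -- in the quotient of the sector
  have hpbm : ∀ t, (eHead hg r₁).symm t ∈ sectorZ g := VanKampen.symm_mem hh
  have h1 : ∀ t, ((eHead hg r₁).symm.trans ℓ) t ∈ sectorZ g := VanKampen.trans_mem hpbm hℓ
  have h2 : ∀ t, ((Path.refl (Ldn g r₁)).trans w.symm) t ∈ sectorZ g :=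
    VanKampen.trans_mem (fun _ => (eHead hg r₁).target ▸ hh 1) (VanKampen.symm_mem hw)
  have heq : cl ((eHead hg r₁).symm.trans ℓ) h1 = cl ((Path.refl (Ldn g r₁)).trans w.symm) h2 :=
    Quotient.sound (hsq.liftPath h1 h2)
  rw [cl_trans_split, cl_trans_split, cl_symm_split, cl_symm_split] at heq
  have hrefl : cl (Path.refl (Ldn g r₁)) (fun _ => (eHead hg r₁).target ▸ hh 1) =
      Path.Homotopic.Quotient.refl _ := by
    rw [← Path.Homotopic.Quotient.mk_refl]
    exact congrArg Path.Homotopic.Quotient.mk (Path.ext (funext fun _ => rfl))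
  rw [hrefl, Path.Homotopic.Quotient.refl_trans] at heq
  have := congrArg Path.Homotopic.Quotient.symm heq
  rw [quot_symm_trans, quot_symm_symm, quot_symm_symm] at this
  exact this.symm

/-- **The twisted `b`-loop.**  Let `TS` be a self-map of the sector fixing every point with
`y ≥ 0`, `y ≤ -ε` or `x ≤ r_a`, equal to `θ(λ(y), ·)` along the head `eHead` of `ℓ_b` (radii
`[r₁, 7^{1/20g}]` of the lower lens edge), where the rest of the lower lens edge has `y ≤ -ε` or
`x ≤ r_a`, `λ` vanishes at the far end of the head and equals the period `T₀` of `P` at `P`.  Then in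
the homotopy quotient of the sector `[TS ∘ ℓ_b] = [ℓ]⁻¹ · [ℓ_b]`, `ℓ(u) = θ(u T₀, P)` the orbit loop.
[cite: FarbMargalit2012, Prop. 3.2] -/
theorem mk_map_loopR_true (hg : 2 ≤ g) {r₁ : ℝ} (hr₁ : rho1 hg < r₁) (hr₁' : r₁ < rt g 7)
    (TS : C(sectorZ g, sectorZ g)) {θ : ℝ × 𝔼 3 → 𝔼 3} {lam : ℝ → ℝ} {T₀ ε : ℝ}
    (hθc : Continuous θ) (h0 : ∀ x, θ (0, x) = x) (hlam : Continuous lam)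
    (hlam₁ : lam (Ldn g r₁ 1) = 0) (hlam0 : lam 0 = T₀) (hT₀ : θ (T₀, ptP g) = ptP g)
    (hfix : ∀ z : sectorZ g, (0 ≤ z.1 1 ∨ z.1 1 ≤ -ε ∨ z.1 0 ≤ ra hg) → TS z = z)
    (hrest : ∀ r ∈ Icc (rho1 hg) r₁, Ldn g r 1 ≤ -ε ∨ Ldn g r 0 ≤ ra hg)
    (hhead : ∀ r (hr : r ∈ Icc r₁ (rt g 7)),
      ((TS ⟨Ldn g r, mapsTo_Ldn hg ⟨hr₁.le.trans hr.1, hr.2⟩⟩ : sectorZ g) : 𝔼 3) = θ (lam (Ldn g r 1), Ldn g r))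
    (horb : ∀ r ∈ Icc r₁ (rt g 7), ∀ s ∈ Icc (0 : ℝ) 1, θ (s * lam (Ldn g r 1), Ldn g r) ∈ sectorZ g)
    (hℓ : ∀ t, orbLoop θ T₀ hθc h0 hT₀ t ∈ sectorZ g)
    (hP : TS ⟨ptP g, ptP_mem_sectorZ hg⟩ = ⟨ptP g, ptP_mem_sectorZ hg⟩) :
    Path.Homotopic.Quotient.mk ((((VanKampen.liftPath (sectorZ g) (loopR hg (0, true))
        (loopR_mem_sectorZ hg (0, true))).map TS.continuous).cast hP.symm hP.symm)) =
      (cl (orbLoop θ T₀ hθc h0 hT₀) hℓ).symm.trans (cl (loopR hg (0, true)) (loopR_mem_sectorZ hg (0, true))) := by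
  -- the three pieces and the twisted head
  have hh : ∀ t, eHead hg r₁ t ∈ sectorZ g := mem_of_isParamOn_Ldn hg (isParamOn_eHead hg hr₁ hr₁')
  have hm : ∀ t, eMid hg r₁ t ∈ sectorZ g := mem_of_isParamOn_Ldn hg (isParamOn_eMid hg hr₁ hr₁')
  have ht : ∀ t, eTail hg t ∈ sectorZ g := mem_of_isParamOn_Lup hg (isParamOn_eTail hg)
  have hw : ∀ t, twHead hg r₁ θ lam hθc h0 hlam hlam₁ hlam0 hT₀ t ∈ sectorZ g := fun t => by
    rw [twHead_apply, eHead_apply]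
    have := horb _ (head_param_mem hr₁' t) 1 ⟨zero_le_one, le_rfl⟩
    rwa [one_mul] at this
  have hL' : ∀ t, (((eHead hg r₁).trans (eMid hg r₁)).trans (eTail hg)) t ∈ sectorZ g :=
    VanKampen.trans_mem (VanKampen.trans_mem hh hm) ht
  have hL'' : ∀ t, (((twHead hg r₁ θ lam hθc h0 hlam hlam₁ hlam0 hT₀).trans (eMid hg r₁)).trans (eTail hg)) t ∈
      sectorZ g := VanKampen.trans_mem (VanKampen.trans_mem hw hm) ht
  have hA := cl_loopR_true_eq_pieces hg hr₁ hr₁' hL'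
  -- Step 1: replace `ℓ_b` by the three pieces under `TS`
  have hB : Path.Homotopic.Quotient.mk (((VanKampen.liftPath (sectorZ g) (loopR hg (0, true))
        (loopR_mem_sectorZ hg (0, true))).map TS.continuous).cast hP.symm hP.symm) =
      Path.Homotopic.Quotient.mk (((VanKampen.liftPath (sectorZ g)
        (((eHead hg r₁).trans (eMid hg r₁)).trans (eTail hg)) hL').map TS.continuous).cast hP.symm hP.symm) := by
    rw [Path.Homotopic.Quotient.mk_cast, Path.Homotopic.Quotient.mk_cast, Path.Homotopic.Quotient.mk_map,
      Path.Homotopic.Quotient.mk_map]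
    exact congrArg (fun q => (Path.Homotopic.Quotient.map q TS).cast hP.symm hP.symm) hA
  -- Step 2: the image of the three pieces, pointwise
  have headeq : ∀ p : I, ((TS ⟨eHead hg r₁ p, hh p⟩ : sectorZ g) : 𝔼 3) =
      twHead hg r₁ θ lam hθc h0 hlam hlam₁ hlam0 hT₀ p := fun p => by
    rw [twHead_apply]
    exact hhead _ (head_param_mem hr₁' _)
  have midfix : ∀ p : I, ((TS ⟨eMid hg r₁ p, hm p⟩ : sectorZ g) : 𝔼 3) = eMid hg r₁ p := fun p => by
    have hfx := hfix ⟨eMid hg r₁ p, hm p⟩ ?_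
    · exact congrArg Subtype.val hfx
    · rcases hrest _ (mid_param_mem hg hr₁ p) with h | h
      · exact Or.inr (Or.inl h)
      · exact Or.inr (Or.inr h)
  have tailfix : ∀ p : I, ((TS ⟨eTail hg p, ht p⟩ : sectorZ g) : 𝔼 3) = eTail hg p := fun p => by
    have hfx := hfix ⟨eTail hg p, ht p⟩
      (Or.inl (Lup_apply_one_nonneg hg ((rho1_pos hg).le.trans (tail_param_mem hg p).1)))
    exact congrArg Subtype.val hfx
  have key : ∀ (x : 𝔼 3) (hx : x ∈ sectorZ g) (t : I), x = (((eHead hg r₁).trans (eMid hg r₁)).trans (eTail hg)) t →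
      ((TS ⟨x, hx⟩ : sectorZ g) : 𝔼 3) =
        (((twHead hg r₁ θ lam hθc h0 hlam hlam₁ hlam0 hT₀).trans (eMid hg r₁)).trans (eTail hg)) t := by
    intro x hx t hxt
    simp only [Path.trans_apply] at hxt ⊢
    split_ifs at hxt ⊢ with h₁ h₂
    · subst hxt; exact headeq _
    · subst hxt; exact midfix _
    · subst hxt; exact tailfix _
  have hC : ((VanKampen.liftPath (sectorZ g) (((eHead hg r₁).trans (eMid hg r₁)).trans (eTail hg)) hL').map
        TS.continuous).cast hP.symm hP.symm =
      VanKampen.liftPath (sectorZ g)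
        (((twHead hg r₁ θ lam hθc h0 hlam hlam₁ hlam0 hT₀).trans (eMid hg r₁)).trans (eTail hg)) hL'' :=
    Path.ext (funext fun t => Subtype.ext (key _ (hL' t) t rfl))
  -- Step 3: assemble in the quotient
  rw [hB, hC]
  change cl (((twHead hg r₁ θ lam hθc h0 hlam hlam₁ hlam0 hT₀).trans (eMid hg r₁)).trans (eTail hg)) hL'' = _
  rw [cl_trans_split, cl_trans_split, cl_twHead hg hr₁' hθc h0 hlam hlam₁ hlam0 hT₀ horb hw hℓ hh, hA,
    cl_trans_split, cl_trans_split]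
  simp only [Path.Homotopic.Quotient.trans_assoc]

/-! ### §5 The action of a sector self-map on the transported basis classes -/

section Quot

variable {X : Type*} [TopologicalSpace X]

/-- `refl⁻¹ = refl` in the homotopy quotient. [folklore] -/
theorem quot_refl_symm (a : X) :
    (Path.Homotopic.Quotient.refl a).symm = Path.Homotopic.Quotient.refl a := by
  rw [← Path.Homotopic.Quotient.mk_refl, ← Path.Homotopic.Quotient.mk_symm, Path.refl_symm]

end Quot

/-- For a self-map of the sector fixing the access path `γ` pointwise, the moved access loop
`γ⁻¹ · TS(γ)` of the transport formula is trivial. [folklore] -/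
theorem mk_accessLoop_eq_refl (hg : 2 ≤ g) (TS : C(sectorZ g, sectorZ g))
    (htop : TS ⟨top g, top_mem_sectorZ hg⟩ = ⟨top g, top_mem_sectorZ hg⟩)
    (hP : TS ⟨ptP g, ptP_mem_sectorZ hg⟩ = ⟨ptP g, ptP_mem_sectorZ hg⟩)
    (hgam : ∀ t, TS (VanKampen.liftPath (sectorZ g) (gam hg) (gam_mem hg) t) =
      VanKampen.liftPath (sectorZ g) (gam hg) (gam_mem hg) t) :
    Path.Homotopic.Quotient.mk ((VanKampen.liftPath (sectorZ g) (gam hg) (gam_mem hg)).symm.trans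
        (((VanKampen.liftPath (sectorZ g) (gam hg) (gam_mem hg)).map TS.continuous).cast htop.symm hP.symm)) =
      Path.Homotopic.Quotient.refl _ := by
  have e : ((VanKampen.liftPath (sectorZ g) (gam hg) (gam_mem hg)).map TS.continuous).cast htop.symm hP.symm =
      VanKampen.liftPath (sectorZ g) (gam hg) (gam_mem hg) := Path.ext (funext fun t => hgam t)
  rw [e, Path.Homotopic.Quotient.mk_trans, Path.Homotopic.Quotient.mk_symm, Path.Homotopic.Quotient.symm_trans]

/-- **A sector self-map fixing `γ` and the basis loop `ℓ_i` pointwise fixes the transported class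
`θ(i)`.** [cite: HatcherAT2002, Prop. 1.5] -/
theorem mapOfEq_sectorZGenClass_of_forall_eq (hg : 2 ≤ g) (TS : C(sectorZ g, sectorZ g))
    (htop : TS ⟨top g, top_mem_sectorZ hg⟩ = ⟨top g, top_mem_sectorZ hg⟩)
    (hP : TS ⟨ptP g, ptP_mem_sectorZ hg⟩ = ⟨ptP g, ptP_mem_sectorZ hg⟩)
    (hgam : ∀ t, TS (VanKampen.liftPath (sectorZ g) (gam hg) (gam_mem hg) t) =
      VanKampen.liftPath (sectorZ g) (gam hg) (gam_mem hg) t)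
    (i : surfaceGen 1)
    (hℓ : ∀ t, TS (VanKampen.liftPath (sectorZ g) (loopR hg i) (loopR_mem_sectorZ hg i) t) =
      VanKampen.liftPath (sectorZ g) (loopR hg i) (loopR_mem_sectorZ hg i) t) :
    FundamentalGroup.mapOfEq TS htop (sectorZGenClass hg i) = sectorZGenClass hg i := by
  have e : ((VanKampen.liftPath (sectorZ g) (loopR hg i) (loopR_mem_sectorZ hg i)).map TS.continuous).cast
      hP.symm hP.symm = VanKampen.liftPath (sectorZ g) (loopR hg i) (loopR_mem_sectorZ hg i) :=
    Path.ext (funext fun t => hℓ t)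
  rw [sectorZGenClass_eq_pathConj, mapOfEq_pathConj_fromPath TS htop hP, mk_accessLoop_eq_refl hg TS htop hP hgam,
    e, quot_refl_symm, Path.Homotopic.Quotient.refl_trans, Path.Homotopic.Quotient.trans_refl]

/-- **A sector self-map twisting `ℓ_b` by a meridian loop.**  If `[TS ∘ ℓ_b] = [ℓ]⁻¹ · [ℓ_b]` in the
homotopy quotient of the sector and `[ℓ] = [ℓ_a]^{±1}`, then `TS_* θ(b) = θ(b) · θ(a)^e` with
`e = ∓1` (Mathlib's `π₁` multiplies in the diagrammatic-opposite order). [cite: FarbMargalit2012, Prop. 3.2] -/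
theorem mapOfEq_sectorZGenClass_true_of_twist (hg : 2 ≤ g) (TS : C(sectorZ g, sectorZ g))
    (htop : TS ⟨top g, top_mem_sectorZ hg⟩ = ⟨top g, top_mem_sectorZ hg⟩)
    (hP : TS ⟨ptP g, ptP_mem_sectorZ hg⟩ = ⟨ptP g, ptP_mem_sectorZ hg⟩)
    (hgam : ∀ t, TS (VanKampen.liftPath (sectorZ g) (gam hg) (gam_mem hg) t) =
      VanKampen.liftPath (sectorZ g) (gam hg) (gam_mem hg) t)
    {ℓ : Path (ptP g) (ptP g)} (hℓ : ∀ t, ℓ t ∈ sectorZ g)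
    (htw : Path.Homotopic.Quotient.mk ((((VanKampen.liftPath (sectorZ g) (loopR hg (0, true))
        (loopR_mem_sectorZ hg (0, true))).map TS.continuous).cast hP.symm hP.symm)) =
      (cl ℓ hℓ).symm.trans (cl (loopR hg (0, true)) (loopR_mem_sectorZ hg (0, true))))
    (hread : cl ℓ hℓ = cl (loopR hg (0, false)) (loopR_mem_sectorZ hg (0, false)) ∨
      cl ℓ hℓ = (cl (loopR hg (0, false)) (loopR_mem_sectorZ hg (0, false))).symm) :
    ∃ e : ℤ, (e = 1 ∨ e = -1) ∧
      FundamentalGroup.mapOfEq TS htop (sectorZGenClass hg (0, true)) =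
        sectorZGenClass hg (0, true) * sectorZGenClass hg (0, false) ^ e := by
  have key : FundamentalGroup.mapOfEq TS htop (sectorZGenClass hg (0, true)) =
      pathConj (VanKampen.liftPath (sectorZ g) (gam hg) (gam_mem hg))
        (FundamentalGroup.fromPath ((cl ℓ hℓ).symm.trans
          (cl (loopR hg (0, true)) (loopR_mem_sectorZ hg (0, true))))) := by
    rw [sectorZGenClass_eq_pathConj, mapOfEq_pathConj_fromPath TS htop hP, mk_accessLoop_eq_refl hg TS htop hP hgam,
      htw, quot_refl_symm, Path.Homotopic.Quotient.refl_trans, Path.Homotopic.Quotient.trans_refl]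
  rcases hread with h | h
  · refine ⟨-1, Or.inr rfl, ?_⟩
    rw [key, h, zpow_neg_one, sectorZGenClass_eq_pathConj, sectorZGenClass_eq_pathConj, ← map_inv, ← map_mul]
    rfl
  · refine ⟨1, Or.inl rfl, ?_⟩
    rw [key, h, quot_symm_symm, zpow_one, sectorZGenClass_eq_pathConj, sectorZGenClass_eq_pathConj, ← map_mul]
    rfl

/-! ### §6 Self-maps of the flower surface supported in the thin strip below the positive `x`-axis -/

/-- **The restriction to the standard sector** of a self-map of `Z_g` preserving it. [folklore] -/
def restrictZ (F : C(flowerSurface g, flowerSurface g))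
    (hF : ∀ z : flowerSurface g, z.1 ∈ sectorZ g → (F z).1 ∈ sectorZ g) : C(sectorZ g, sectorZ g) :=
  ⟨fun z => ⟨(F ⟨z.1, z.2.1⟩).1, hF ⟨z.1, z.2.1⟩ z.2⟩,
    (continuous_subtype_val.comp (F.continuous.comp (continuous_subtype_val.subtype_mk _))).subtype_mk _⟩

/-- `restrictZ`, on points. [folklore] -/
@[simp] theorem restrictZ_apply_coe (F : C(flowerSurface g, flowerSurface g))
    (hF : ∀ z : flowerSurface g, z.1 ∈ sectorZ g → (F z).1 ∈ sectorZ g) (z : sectorZ g) :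
    ((restrictZ F hF z : sectorZ g) : 𝔼 3) = (F ⟨z.1, z.2.1⟩).1 := rfl

/-- The standard sector lies on the flower surface. [folklore] -/
theorem sectorZ_subset_flowerSurface : sectorZ g ⊆ flowerSurface g := fun _ hp => hp.1

/-- **`F_* ∘ ι_* = ι_* ∘ (F|Z)_*`** for the inclusion `ι` of the standard sector. [folklore] -/
theorem mapOfEq_inclHomOfSubset_sectorZ (hg : 2 ≤ g) (F : C(flowerSurface g, flowerSurface g))
    (hF : ∀ z : flowerSurface g, z.1 ∈ sectorZ g → (F z).1 ∈ sectorZ g)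
    (htopF : F ⟨top g, top_mem_flowerSurface hg⟩ = ⟨top g, top_mem_flowerSurface hg⟩)
    (htopS : restrictZ F hF ⟨top g, top_mem_sectorZ hg⟩ = ⟨top g, top_mem_sectorZ hg⟩)
    (hZ : sectorZ g ⊆ flowerSurface g)
    (x : FundamentalGroup (sectorZ g) ⟨top g, top_mem_sectorZ hg⟩) :
    FundamentalGroup.mapOfEq F htopF
        (VanKampen.inclHomOfSubset hZ (top g) (top_mem_sectorZ hg) (top_mem_flowerSurface hg) x) =
      VanKampen.inclHomOfSubset hZ (top g) (top_mem_sectorZ hg) (top_mem_flowerSurface hg)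
        (FundamentalGroup.mapOfEq (restrictZ F hF) htopS x) := by
  simp only [VanKampen.inclHomOfSubset]
  rw [← mapOfEq_comp_apply, ← mapOfEq_comp_apply]
  exact mapOfEq_congr_map (ContinuousMap.ext fun p => Subtype.ext rfl) _ _ _

/-- **A self-map fixing a slice pointwise fixes the image of its `π₁`.** [folklore] -/
theorem mapOfEq_inclHomOfSubset_of_forall_eq (hg : 2 ≤ g) (F : C(flowerSurface g, flowerSurface g))
    (htopF : F ⟨top g, top_mem_flowerSurface hg⟩ = ⟨top g, top_mem_flowerSurface hg⟩)
    {k : ℕ} (hk : secS g k ⊆ flowerSurface g) (hfix : ∀ z : flowerSurface g, z.1 ∈ secS g k → F z = z)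
    (x : FundamentalGroup (secS g k) ⟨top g, range_arcK_subset hg k ⟨0, (arcK hg k).source⟩⟩) :
    FundamentalGroup.mapOfEq F htopF
        (VanKampen.inclHomOfSubset hk (top g) (range_arcK_subset hg k ⟨0, (arcK hg k).source⟩)
          (top_mem_flowerSurface hg) x) =
      VanKampen.inclHomOfSubset hk (top g) (range_arcK_subset hg k ⟨0, (arcK hg k).source⟩)
        (top_mem_flowerSurface hg) x := by
  simp only [VanKampen.inclHomOfSubset]
  rw [← mapOfEq_comp_apply]
  exact mapOfEq_congr_map (ContinuousMap.ext fun p => hfix ⟨p.1, hk p.2⟩ p.2) _ _ _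

/-- The rotation `R_k` with `g ∣ k` is the identity. [folklore] -/
theorem Rk_apply_of_mod_eq_zero (hg : 2 ≤ g) {k : ℕ} (hk : k % g = 0) (p : 𝔼 3) : Rk g k p = p := by
  have hg1 : 1 ≤ g := by omega
  have h0 : ζC g k = 1 := by
    rw [ζC_eq_of_mod_eq hg1 (hk.trans (Nat.zero_mod g).symm)]
    simp [ζC]
  rw [Rk, h0, inv_one, rot3_apply, rot_one, lift_proj_add]

/-- **The marking values of the `0`-th slice are those of the standard sector**:
`ι_0 θ_0(i) = ι θ(i)` (`R_0 = id`). [folklore] -/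
theorem inclHomOfSubset_secSGenClass_of_mod_eq_zero (hg : 2 ≤ g) {k : ℕ} (hk : k % g = 0)
    (h0 : secS g k ⊆ flowerSurface g) (hZ : sectorZ g ⊆ flowerSurface g) (i : surfaceGen 1) :
    VanKampen.inclHomOfSubset h0 (top g) (range_arcK_subset hg k ⟨0, (arcK hg k).source⟩)
        (top_mem_flowerSurface hg) (secSGenClass hg k i) =
      VanKampen.inclHomOfSubset hZ (top g) (top_mem_sectorZ hg) (top_mem_flowerSurface hg)
        (sectorZGenClass hg i) := by
  simp only [secSGenClass, fundamentalGroupEquivOfHomeomorph_apply, VanKampen.inclHomOfSubset]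
  rw [← mapOfEq_comp_apply]
  refine mapOfEq_congr_map (ContinuousMap.ext fun p => Subtype.ext ?_) _ _ _
  show Rk g k p.1 = p.1
  exact Rk_apply_of_mod_eq_zero hg hk p.1

/-- **The induced self-map of `Z_g`** of a self-diffeomorphism of `∂V_g`, through
`boundaryHomeomorph : ∂V_g ≃ₜ Z_g`. [folklore] -/
def onZ (hg : 2 ≤ g)
    (T : (𝓡∂ 3).boundary (FlowerHandlebody hg) ≃ₘ⟮𝓡 2, 𝓡 2⟯ (𝓡∂ 3).boundary (FlowerHandlebody hg)) :
    C(flowerSurface g, flowerSurface g) :=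
  ⟨fun w => boundaryHomeomorph hg (T ((boundaryHomeomorph hg).symm w)),
    (boundaryHomeomorph hg).continuous.comp (T.continuous.comp (boundaryHomeomorph hg).symm.continuous)⟩

/-- `onZ`, on points. [folklore] -/
theorem onZ_apply_coe (hg : 2 ≤ g)
    (T : (𝓡∂ 3).boundary (FlowerHandlebody hg) ≃ₘ⟮𝓡 2, 𝓡 2⟯ (𝓡∂ 3).boundary (FlowerHandlebody hg))
    (w : flowerSurface g) :
    ((onZ hg T w : flowerSurface g) : 𝔼 3) = boundaryIncl hg (T ((boundaryHomeomorph hg).symm w)) := rfl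

/-- `boundaryIncl ∘ boundaryHomeomorph⁻¹` is the inclusion. [folklore] -/
theorem boundaryIncl_symm_apply (hg : 2 ≤ g) (w : flowerSurface g) :
    boundaryIncl hg ((boundaryHomeomorph hg).symm w) = w := by
  have h := boundaryHomeomorph_apply_coe hg ((boundaryHomeomorph hg).symm w)
  rw [Homeomorph.apply_symm_apply] at h
  exact h.symm

/-- `onZ T` fixes the pole when `T` fixes the base point. [folklore] -/
theorem onZ_top (hg : 2 ≤ g)
    (T : (𝓡∂ 3).boundary (FlowerHandlebody hg) ≃ₘ⟮𝓡 2, 𝓡 2⟯ (𝓡∂ 3).boundary (FlowerHandlebody hg))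
    (hT : T (northPole hg) = northPole hg) :
    onZ hg T ⟨top g, top_mem_flowerSurface hg⟩ = ⟨top g, top_mem_flowerSurface hg⟩ := by
  show boundaryHomeomorph hg (T ((boundaryHomeomorph hg).symm ⟨top g, top_mem_flowerSurface hg⟩)) = _
  rw [← boundaryHomeomorph_northPole hg, Homeomorph.symm_apply_apply, hT]
  exact boundaryHomeomorph_northPole hg

/-- **Under `∂V_g ≃ₜ Z_g`, `T_#` is `(onZ T)_*`.** [folklore] -/
theorem mapOfEq_boundaryHomeomorph_onZ (hg : 2 ≤ g)
    (T : (𝓡∂ 3).boundary (FlowerHandlebody hg) ≃ₘ⟮𝓡 2, 𝓡 2⟯ (𝓡∂ 3).boundary (FlowerHandlebody hg))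
    (hT : T (northPole hg) = northPole hg)
    (γ : FundamentalGroup ((𝓡∂ 3).boundary (FlowerHandlebody hg)) (northPole hg)) :
    fundamentalGroupEquivOfHomeomorph (boundaryHomeomorph hg) (boundaryHomeomorph_northPole hg)
        (Homeomorph.fundamentalGroupCongr T.toHomeomorph hT γ) =
      FundamentalGroup.mapOfEq (onZ hg T) (onZ_top hg T hT)
        (fundamentalGroupEquivOfHomeomorph (boundaryHomeomorph hg) (boundaryHomeomorph_northPole hg) γ) := by
  simp only [fundamentalGroupEquivOfHomeomorph_apply, Homeomorph.fundamentalGroupCongr_apply]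
  refine ((mapOfEq_comp_apply _ _ hT (boundaryHomeomorph_northPole hg)
    γ).symm.trans ?_).trans (mapOfEq_comp_apply _ _ (boundaryHomeomorph_northPole hg)
      (onZ_top hg T hT) γ)
  refine mapOfEq_congr_map (ContinuousMap.ext fun z => ?_) _ _ _
  show boundaryHomeomorph hg (T z) = boundaryHomeomorph hg (T ((boundaryHomeomorph hg).symm (boundaryHomeomorph hg z)))
  rw [Homeomorph.symm_apply_apply]

/-! ### §7 Orbits at small height stay to the right of `x = r_a`; the flow chart at `P` -/

/-- `π(p) = (p_x, 0) + p_y (0, 1)`. [folklore] -/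
theorem proj_eq_ax_add_smul (p : 𝔼 3) : proj p = ax (p 0) + p 1 • e₁ := by
  apply toC.injective
  rw [toC_ax_add_smul_e₁]
  apply Complex.ext
  · rw [re_toC]; simp
  · rw [im_toC]; simp

/-- `((r, 0) + t (0, 1))_x = r`. [folklore] -/
theorem ax_add_smul_e₁_apply_zero (r t : ℝ) : (ax r + t • e₁) 0 = r := by
  rw [← re_toC, toC_ax_add_smul_e₁]; simp

/-- The pole lies in the plane `y = 0`. [folklore] -/
theorem top_apply_one (g : ℕ) : top g 1 = 0 := by
  simp [top]

/-- **Over the peak line `x = r_a` the flower function exceeds the level for small `|y|`**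
(`q_g(r_a, 0) = prof(r_a) > c_g` and continuity). [folklore] -/
theorem exists_eps_level_lt_flower_line (hg : 2 ≤ g) :
    ∃ ε₁ : ℝ, 0 < ε₁ ∧ ∀ a, |a| ≤ ε₁ → level g < flower g (ax (ra hg) + a • e₁) := by
  have hc : Continuous fun a : ℝ => flower g (ax (ra hg) + a • e₁) :=
    contDiff_flower.continuous.comp (continuous_const.add (continuous_id.smul continuous_const))
  have h0 : level g < flower g (ax (ra hg) + (0 : ℝ) • e₁) := by
    rw [zero_smul, add_zero, flower_ax']; exact level_lt_prof_ra hg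
  have hev : ∀ᶠ a in 𝓝 (0 : ℝ), level g < flower g (ax (ra hg) + a • e₁) :=
    hc.continuousAt.eventually (lt_mem_nhds h0)
  obtain ⟨ε, hε, h⟩ := Metric.eventually_nhds_iff.1 hev
  refine ⟨ε / 2, by positivity, fun a ha => h ?_⟩
  rw [Real.dist_eq, sub_zero]
  exact lt_of_le_of_lt ha (by linarith)

section Package

variable {θ : ℝ × 𝔼 3 → 𝔼 3} {ψ : 𝔼 3 → ℝ} {δ : ℝ}

/-- **Orbits at small height stay to the right of `x = r_a`**: along an `H`-preserving flow, a
point of the level `{q_g ∘ π + z² = c_g}` with `|y| ≤ ε₁` and `x > r_a` keeps `x > r_a` (at a crossing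
of `x = r_a` the level would be `≥ q_g(r_a, y) > c_g`; intermediate value theorem). [folklore] -/
theorem ra_lt_orbit_apply_zero (hg : 2 ≤ g) (hθc : Continuous θ) (h0 : ∀ x, θ (0, x) = x)
    (hHinv : ∀ t x, merH g (θ (t, x)) = merH g x)
    {ε₁ : ℝ} (hε₁ : ∀ a, |a| ≤ ε₁ → level g < flower g (ax (ra hg) + a • e₁))
    {p : 𝔼 3} (hpy : |p 1| ≤ ε₁) (hpc : thicken (flower g) p = level g) (hpx : ra hg < p 0) (u : ℝ) :
    ra hg < θ (u, p) 0 := by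
  by_contra hle
  push Not at hle
  set X : ℝ → ℝ := fun s => θ (s, p) 0 with hX
  have hXc : Continuous X :=
    (EuclideanSpace.proj (0 : Fin 3)).continuous.comp (hθc.comp (continuous_id.prodMk continuous_const))
  have hX0 : X 0 = p 0 := by simp [hX, h0]
  obtain ⟨s, -, hs⟩ : ra hg ∈ X '' uIcc u 0 :=
    intermediate_value_uIcc hXc.continuousOn (mem_uIcc.2 (Or.inl ⟨hle, by rw [hX0]; exact hpx.le⟩))
  have hy : θ (s, p) 1 = p 1 ∧ thicken (flower g) (θ (s, p)) = level g := by
    have h := hHinv s p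
    rw [merH, pairH_apply, pairH_apply, Prod.mk.injEq] at h
    exact ⟨h.1, h.2.trans hpc⟩
  have h1 : proj (θ (s, p)) = ax (ra hg) + p 1 • e₁ := by
    rw [proj_eq_ax_add_smul, hy.1]
    exact congrArg (fun r => ax r + p 1 • e₁) hs
  have h2 : thicken (flower g) (θ (s, p)) = flower g (ax (ra hg) + p 1 • e₁) + θ (s, p) 2 ^ 2 := by
    rw [thicken_apply, h1]
  nlinarith [hy.2, hε₁ _ hpy, sq_nonneg (θ (s, p) 2)]

/-- **The flow chart at the lens tip `P`**: an open neighbourhood of `P` in `ℝ³` inside the image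
of `(u, s) ↦ θ(u, sec s)`, `s` in the `δ`-box (inverse function theorem). [cite: LeeSmoothManifolds2013, Thm. 9.22] -/
theorem exists_nhds_ptP_flowChart (hg : 2 ≤ g) (hθ : ContDiff ℝ ∞ θ) (h0 : ∀ x, θ (0, x) = x)
    (hint : ∀ x t, HasDerivAt (fun t => θ (t, x)) (twistField bE3 bF2 (merH g) ψ (θ (t, x))) t)
    (hHinv : ∀ t x, merH g (θ (t, x)) = merH g x) {δr : ℝ}
    (hreg : ∀ x : 𝔼 3, |x 1| < δr → |thicken (flower g) x - level g| < δr →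
      LinearMap.range (fderiv ℝ (merH g) x : 𝔼 3 →ₗ[ℝ] ℝ × ℝ) = ⊤)
    (hδ : 0 < δ) (hδr : 0 < δr)
    (hψ1 : ∀ x, merH g x ∈ Ioo (-δ) δ ×ˢ Ioo (level g - δ) (level g + δ) → ψ x = 1)
    {sec : ℝ × ℝ → 𝔼 3} (hσs : ContDiff ℝ ∞ sec)
    (hHσ : ∀ s ∈ Ioo (-δ) δ ×ˢ Ioo (level g - δ) (level g + δ), merH g (sec s) = s)
    (hσ0 : sec (0, level g) = Cup g (rb hg)) {uP : ℝ} (huP : θ (uP, Cup g (rb hg)) = ptP g) :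
    ∃ N : Set (𝔼 3), IsOpen N ∧ ptP g ∈ N ∧
      ∀ w ∈ N, ∃ u : ℝ, ∃ s ∈ Ioo (-δ) δ ×ˢ Ioo (level g - δ) (level g + δ), θ (u, sec s) = w := by
  set s₀ : ℝ × ℝ := (0, level g) with hs₀
  set box : Set (ℝ × ℝ) := Ioo (-δ) δ ×ˢ Ioo (level g - δ) (level g + δ) with hbox
  have hbox_open : IsOpen box := isOpen_Ioo.prod isOpen_Ioo
  have hs₀box : s₀ ∈ box := ⟨⟨by linarith, hδ⟩, ⟨by linarith, by linarith⟩⟩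
  have hev : ∀ᶠ s' in 𝓝 s₀, merH g (sec s') = s' := by
    filter_upwards [hbox_open.mem_nhds hs₀box] with s' hs' using hHσ s' hs'
  have hmem := orbit_mem_merC hg hθ.continuous h0 hHinv uP
  have hv0 : twistField bE3 bF2 (merH g) ψ (θ (uP, sec s₀)) ≠ 0 := by
    rw [hσ0]
    exact twistField_merH_ne_zero hreg hδ hδr hψ1 hmem.1 hmem.2.1
  obtain ⟨L, hL⟩ := exists_equiv_hasStrictFDerivAt_of_finrank finrank_E3_eq hθ
    (contDiff_pairH contDiff_apply_one contDiff_flower) hHinv hσs hev uP (hint (sec s₀) uP) hv0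
  have hW : (univ : Set ℝ) ×ˢ box ∈ 𝓝 (uP, s₀) := prod_mem_nhds univ_mem (hbox_open.mem_nhds hs₀box)
  have himg : (fun p : ℝ × (ℝ × ℝ) => θ (p.1, sec p.2)) '' ((univ : Set ℝ) ×ˢ box) ∈ 𝓝 (θ (uP, sec s₀)) := by
    rw [← hL.map_nhds_eq_of_equiv]
    exact image_mem_map hW
  obtain ⟨N, hNsub, hNo, hN⟩ := _root_.mem_nhds_iff.1 himg
  refine ⟨N, hNo, ?_, fun w hw => ?_⟩
  · rw [← huP, ← hσ0]; exact hN
  · obtain ⟨⟨t, s⟩, ⟨-, hs⟩, rfl⟩ := hNsub hw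
    exact ⟨t, s, hs, rfl⟩

/-- **Points of the flow family on the level `{y = 0, q_g ∘ π + z² = c_g}` have period `T₀`** (they
are on the orbit of the section point `sec(0, c_g)`). [folklore] -/
theorem apply_period_of_mem_flowSaturation {sec : ℝ × ℝ → 𝔼 3} {S box : Set (ℝ × ℝ)} {T₀ : ℝ}
    (hadd : ∀ t s x, θ (t, θ (s, x)) = θ (t + s, x)) (hHinv : ∀ t x, merH g (θ (t, x)) = merH g x)
    (hHσ : ∀ s ∈ box, merH g (sec s) = s) (hSsub : S ⊆ box)
    (hT₀m : θ (T₀, sec (0, level g)) = sec (0, level g)) {p : 𝔼 3} (hp : p ∈ flowSaturation θ sec S)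
    (hp1 : p 1 = 0) (hpc : thicken (flower g) p = level g) : θ (T₀, p) = p := by
  obtain ⟨u, s, hs, rfl⟩ := mem_flowSaturation_iff.1 hp
  have hs0 : s = (0, level g) := by
    rw [← hHσ s (hSsub hs), ← hHinv u]; exact merH_eq_iff.2 ⟨hp1, hpc⟩
  subst hs0
  rw [hadd, add_comm, ← hadd, hT₀m]

end Package

/-! ### §8 The meridian twist, read on `Z_g`: support and action on the sector classes -/

/-- **The meridian Dehn twist read on `Z_g`.**  The based Dehn twist `T` of `∂V_g` about the meridian
`m₀` (`exists_meridianDehnTwist`, with the minimal period and a thin enough collar) induces a self-map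
`onZ T` of `Z_g` which maps the standard sector into itself, fixes the slices `1, …, g-1` pointwise,
fixes the transported class `θ(a)` of the standard sector and sends `θ(b)` to `θ(b) · θ(a)^e`,
`e = ±1`. [cite: FarbMargalit2012, §3.1.1, Prop. 3.2] [cite: ZieschangVogtColdewey1980, Thm. 5.6.1] -/
theorem exists_meridianTwist_onZ (hg : 2 ≤ g) :
    ∃ (T : (𝓡∂ 3).boundary (FlowerHandlebody hg) ≃ₘ⟮𝓡 2, 𝓡 2⟯ (𝓡∂ 3).boundary (FlowerHandlebody hg))
      (_ : T (northPole hg) = northPole hg) (e : ℤ)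
      (hF : ∀ z : flowerSurface g, z.1 ∈ sectorZ g → (onZ hg T z).1 ∈ sectorZ g)
      (htopS : restrictZ (onZ hg T) hF ⟨top g, top_mem_sectorZ hg⟩ = ⟨top g, top_mem_sectorZ hg⟩),
      (e = 1 ∨ e = -1) ∧
      (∀ k, 1 ≤ k → k + 1 ≤ g → ∀ w : flowerSurface g, w.1 ∈ secS g k → onZ hg T w = w) ∧
      FundamentalGroup.mapOfEq (restrictZ (onZ hg T) hF) htopS (sectorZGenClass hg (0, false)) =
        sectorZGenClass hg (0, false) ∧
      FundamentalGroup.mapOfEq (restrictZ (onZ hg T) hF) htopS (sectorZGenClass hg (0, true)) =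
        sectorZGenClass hg (0, true) * sectorZGenClass hg (0, false) ^ e := by
  -- the meridian twist package and the meridian orbit package
  obtain ⟨δ, sec, ψ, θ, hδ, hσs, hHσ, hσproj, hσ0, -, hψ1, -, hθ, h0, hadd, hint, hHinv, -, hper, htwist⟩ :=
    exists_meridianDehnTwist hg
  obtain ⟨δr, hδr, hreg⟩ := exists_delta_range_fderiv_merH hg
  have hσ0' : sec (0, level g) = Cup g (rb hg) := hσ0.trans (Cup_rb_eq hg).symm
  have hper' : ∃ T : ℝ, 0 < T ∧ θ (T, Cup g (rb hg)) = Cup g (rb hg) := by rw [← hσ0']; exact hper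
  obtain ⟨uP, T₀, huP, hT₀, hT₀m, hT₀P, -, hPmem, hread⟩ :=
    exists_meridianOrbit hg hθ h0 hadd hint hHinv hreg hδ hδr hψ1 hσs hHσ hσ0' hper'
  have hT₀m' : θ (T₀, sec (0, level g)) = sec (0, level g) := by rw [hσ0']; exact hT₀m
  -- the constants: `ε₁` (peak line), `ε₂` (planar separation), the chart at `P`, `r₁`, `η₀`
  obtain ⟨ε₁, hε₁, hε₁lt⟩ := exists_eps_level_lt_flower_line hg
  have hπg : 0 < π / g := div_pos Real.pi_pos (by exact_mod_cast (show 0 < g by omega))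
  have hsin : 0 < Real.sin (π / g) :=
    Real.sin_pos_of_pos_of_lt_pi hπg ((pi_div_le_pi_div_two hg).trans_lt (by linarith [Real.pi_pos]))
  have hε₂ : 0 < ra hg * Real.sin (π / g) := mul_pos (ra_pos hg) hsin
  obtain ⟨N, hNo, hPN, hN⟩ := exists_nhds_ptP_flowChart hg hθ h0 hint hHinv hreg hδ hδr hψ1 hσs hHσ hσ0' huP
  obtain ⟨r₁, hr₁ρ, hr₁a, hr₁', hheadN⟩ : ∃ r₁, rho1 hg < r₁ ∧ ra hg < r₁ ∧ r₁ < rt g 7 ∧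
      ∀ r ∈ Icc r₁ (rt g 7), Ldn g r ∈ N ∧ ra hg < Ldn g r 0 := by
    have hN' : IsOpen (N ∩ {p : 𝔼 3 | ra hg < p 0}) :=
      hNo.inter (isOpen_lt continuous_const (EuclideanSpace.proj (0 : Fin 3)).continuous)
    have hPN' : Ldn g (rt g 7) ∈ N ∩ {p : 𝔼 3 | ra hg < p 0} := by
      rw [Ldn_rt_seven hg]
      refine ⟨hPN, ?_⟩
      show ra hg < ptP g 0
      rw [ptP_apply_zero]; exact ra_lt_rt_seven hg
    have hpre : Ldn g ⁻¹' (N ∩ {p : 𝔼 3 | ra hg < p 0}) ∈ 𝓝 (rt g 7) :=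
      (hN'.preimage (continuous_Ldn hg)).mem_nhds hPN'
    obtain ⟨κ, hκ, hκsub⟩ := Metric.mem_nhds_iff.1 hpre
    have hρa := (rho1_mem hg).2
    have hat := ra_lt_rt_seven hg
    refine ⟨rt g 7 - min (κ / 2) ((rt g 7 - ra hg) / 2), ?_, ?_, ?_, fun r hr => ?_⟩
    · have := min_le_right (κ / 2) ((rt g 7 - ra hg) / 2); linarith
    · have := min_le_right (κ / 2) ((rt g 7 - ra hg) / 2); linarith
    · have := lt_min (by positivity : (0:ℝ) < κ / 2) (by linarith : (0:ℝ) < (rt g 7 - ra hg) / 2); linarith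
    · have h1 := min_le_left (κ / 2) ((rt g 7 - ra hg) / 2)
      have hmem : r ∈ Metric.ball (rt g 7) κ := by
        rw [Metric.mem_ball, Real.dist_eq, abs_lt]
        constructor <;> linarith [hr.1, hr.2]
      exact hκsub hmem
  obtain ⟨η₀, hη₀, hη⟩ : ∃ η₀, 0 < η₀ ∧ ∀ r ∈ Icc (ra hg) r₁, Ldn g r 1 ≤ -η₀ := by
    have hc : ContinuousOn (fun r => Ldn g r 1) (Icc (ra hg) r₁) :=
      ((EuclideanSpace.proj (1 : Fin 3)).continuous.comp (continuous_Ldn hg)).continuousOn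
    obtain ⟨r₀, hr₀, hmax⟩ := isCompact_Icc.exists_isMaxOn (nonempty_Icc.2 hr₁a.le) hc
    refine ⟨-Ldn g r₀ 1, ?_, fun r hr => ?_⟩
    · rw [neg_pos]; exact Ldn_apply_one_neg hg ((rho1_mem hg).2.trans_le hr₀.1) (hr₀.2.trans_lt hr₁')
    · rw [neg_neg]; exact hmax hr
  -- the twist
  have hε₀ : 0 < min (min ε₁ (ra hg * Real.sin (π / g))) η₀ := lt_min (lt_min hε₁ hε₂) hη₀
  obtain ⟨P, S, ε, lam, T, -, -, hSsub, -, hP0, -, -, -, hε, hεε₀, hparS, hlamC, hlam0, hlam1,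
    hTnp, hTon, hToff⟩ := htwist T₀ hT₀ hT₀m' _ hε₀
  have hεε₁ : ε ≤ ε₁ := hεε₀.trans ((min_le_left _ _).trans (min_le_left _ _))
  have hεε₂ : ε ≤ ra hg * Real.sin (π / g) := hεε₀.trans ((min_le_left _ _).trans (min_le_right _ _))
  have hεη : ε ≤ η₀ := hεε₀.trans (min_le_right _ _)
  -- bookkeeping on `H = (y, q ∘ π + z²)`
  have hsurf : ∀ z, thicken (flower g) (boundaryIncl hg z) = level g := fun z => (boundaryHomeomorph hg z).2
  have hHy : ∀ t x, θ (t, x) 1 = x 1 := fun t x => by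
    have h := hHinv t x
    rw [pairH_apply, pairH_apply, Prod.mk.injEq] at h
    exact h.1
  have hHc : ∀ t x, thicken (flower g) (θ (t, x)) = thicken (flower g) x := fun t x => by
    have h := hHinv t x
    rw [pairH_apply, pairH_apply, Prod.mk.injEq] at h
    exact h.2
  have hσx : ∀ s, sec s 0 = rb hg := fun s => by
    rw [← proj_apply_zero, hσproj, ax_add_smul_e₁_apply_zero]
  -- (T1) the twist fixes every point with `y ≥ 0`, `y ≤ -ε` or off the flow family
  have hfixT : ∀ z, (0 ≤ boundaryIncl hg z 1 ∨ boundaryIncl hg z 1 ≤ -ε ∨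
      boundaryIncl hg z ∉ flowSaturation θ sec S) → T z = z := by
    intro z hz
    by_cases hsat : boundaryIncl hg z ∈ flowSaturation θ sec S
    · rcases hz with h | h | h
      · rcases h.lt_or_eq with h' | h'
        · exact hToff z (Or.inr fun hm => absurd hm.2 (not_le.2 h'))
        · apply (boundaryIncl_inj hg).1
          rw [hTon z hsat (by rw [← h']; linarith), ← h', hlam1 0 ⟨le_rfl, by linarith⟩, hP0]
          exact apply_period_of_mem_flowSaturation hadd hHinv hHσ hSsub hT₀m' hsat h'.symm (hsurf z)
      · rcases h.lt_or_eq with h' | h'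
        · exact hToff z (Or.inr fun hm => absurd hm.1 (not_le.2 (by linarith)))
        · apply (boundaryIncl_inj hg).1
          rw [hTon z hsat (by rw [h']; linarith), h', hlam0 (-ε) (by linarith), h0]
      · exact absurd hsat h
    · exact hToff z (Or.inl hsat)
  -- (T2) a moved point and its image are thin points below the positive `x`-axis
  have hmov : ∀ z, T z ≠ z →
      (ra hg < boundaryIncl hg z 0 ∧ boundaryIncl hg z 1 ∈ Ioo (-ε) 0) ∧
      (ra hg < boundaryIncl hg (T z) 0 ∧ boundaryIncl hg (T z) 1 ∈ Ioo (-ε) 0) := by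
    intro z hz
    have h1 : ¬ 0 ≤ boundaryIncl hg z 1 := fun h => hz (hfixT z (Or.inl h))
    have h2 : ¬ boundaryIncl hg z 1 ≤ -ε := fun h => hz (hfixT z (Or.inr (Or.inl h)))
    have hsat : boundaryIncl hg z ∈ flowSaturation θ sec S := by
      by_contra h
      exact hz (hfixT z (Or.inr (Or.inr h)))
    push Not at h1 h2
    have hy : boundaryIncl hg z 1 ∈ Ioo (-ε) 0 := ⟨h2, h1⟩
    have hyε₁ : |boundaryIncl hg z 1| ≤ ε₁ :=
      (abs_lt.2 ⟨by linarith [hy.1], by linarith [hy.2]⟩ : |boundaryIncl hg z 1| < ε).le.trans hεε₁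
    obtain ⟨u, s, hs, hzs⟩ := mem_flowSaturation_iff.1 hsat
    have hx : ra hg < boundaryIncl hg z 0 := by
      have hs1 : sec s 1 = boundaryIncl hg z 1 := by rw [← hzs, hHy]
      have hsc : thicken (flower g) (sec s) = level g := by rw [← hHc u, hzs]; exact hsurf z
      rw [← hzs]
      exact ra_lt_orbit_apply_zero hg hθ.continuous h0 hHinv hε₁lt (by rw [hs1]; exact hyε₁) hsc
        (by rw [hσx]; exact ra_lt_rb hg) u
    refine ⟨⟨hx, hy⟩, ?_, ?_⟩
    · rw [hTon z hsat (by linarith [hy.2])]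
      exact ra_lt_orbit_apply_zero hg hθ.continuous h0 hHinv hε₁lt hyε₁ (hsurf z) hx _
    · rw [hTon z hsat (by linarith [hy.2]), hHy]
      exact hy
  -- (Z) the induced map of `Z_g`: support
  have hG1 : ∀ w : flowerSurface g, ¬ (ra hg < w.1 0 ∧ w.1 1 ∈ Ioo (-ε) 0) → onZ hg T w = w := by
    intro w hw
    apply Subtype.ext
    rw [onZ_apply_coe]
    by_cases hz : T ((boundaryHomeomorph hg).symm w) = (boundaryHomeomorph hg).symm w
    · rw [hz, boundaryIncl_symm_apply]
    · exact absurd (by simpa only [boundaryIncl_symm_apply] using (hmov _ hz).1) hw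
  have hG2 : ∀ w : flowerSurface g, (ra hg < w.1 0 ∧ w.1 1 ∈ Ioo (-ε) 0) →
      ra hg < (onZ hg T w).1 0 ∧ (onZ hg T w).1 1 ∈ Ioo (-ε) 0 := by
    intro w hw
    by_cases hz : T ((boundaryHomeomorph hg).symm w) = (boundaryHomeomorph hg).symm w
    · have : onZ hg T w = w := Subtype.ext (by rw [onZ_apply_coe, hz, boundaryIncl_symm_apply])
      rw [this]; exact hw
    · rw [onZ_apply_coe]; exact (hmov _ hz).2
  have hF : ∀ w : flowerSurface g, w.1 ∈ sectorZ g → (onZ hg T w).1 ∈ sectorZ g := by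
    intro w hw
    by_cases hm : ra hg < w.1 0 ∧ w.1 1 ∈ Ioo (-ε) 0
    · have h := hG2 w hm
      exact mem_sectorZ_of_coord hg hεε₂ (onZ hg T w).2 h.1 h.2
    · rw [hG1 w hm]; exact hw
  have hfixk : ∀ k, 1 ≤ k → k + 1 ≤ g → ∀ w : flowerSurface g, w.1 ∈ secS g k → onZ hg T w = w := by
    intro k hk1 hkg w hw
    by_cases hm : ra hg < w.1 0 ∧ w.1 1 ∈ Ioo (-ε) 0
    · exact absurd hw (not_mem_secS_of_coord hg hεε₂ hm.1 hm.2 hk1 hkg)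
    · exact hG1 w hm
  -- (S) the restriction to the standard sector
  have hfixS : ∀ z : sectorZ g, (0 ≤ z.1 1 ∨ z.1 1 ≤ -ε ∨ z.1 0 ≤ ra hg) →
      restrictZ (onZ hg T) hF z = z := by
    intro z hz
    apply Subtype.ext
    rw [restrictZ_apply_coe, hG1]
    rintro ⟨hx, hy⟩
    rcases hz with h | h | h
    · exact absurd hy.2 (not_lt.2 h)
    · exact absurd hy.1 (not_lt.2 h)
    · exact absurd hx (not_lt.2 h)
  have htopS : restrictZ (onZ hg T) hF ⟨top g, top_mem_sectorZ hg⟩ = ⟨top g, top_mem_sectorZ hg⟩ :=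
    hfixS _ (Or.inl (le_of_eq (top_apply_one g).symm))
  have hPS : restrictZ (onZ hg T) hF ⟨ptP g, ptP_mem_sectorZ hg⟩ = ⟨ptP g, ptP_mem_sectorZ hg⟩ :=
    hfixS _ (Or.inl (le_of_eq (ptP_apply_one g).symm))
  have hgamS : ∀ t, restrictZ (onZ hg T) hF (VanKampen.liftPath (sectorZ g) (gam hg) (gam_mem hg) t) =
      VanKampen.liftPath (sectorZ g) (gam hg) (gam_mem hg) t := fun t =>
    hfixS _ (Or.inl (gam_apply_one_nonneg hg t))
  have hℓa : ∀ t, restrictZ (onZ hg T) hF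
      (VanKampen.liftPath (sectorZ g) (loopR hg (0, false)) (loopR_mem_sectorZ hg (0, false)) t) =
      VanKampen.liftPath (sectorZ g) (loopR hg (0, false)) (loopR_mem_sectorZ hg (0, false)) t := fun t =>
    hfixS _ (Or.inl (le_of_eq (loopR_false_apply_one hg t).symm))
  -- (H) the hypotheses of the twisted-loop computation
  have hhead : ∀ r (hr : r ∈ Icc r₁ (rt g 7)),
      ((restrictZ (onZ hg T) hF ⟨Ldn g r, mapsTo_Ldn hg ⟨hr₁ρ.le.trans hr.1, hr.2⟩⟩ : sectorZ g) : 𝔼 3) =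
        θ (lam (Ldn g r 1), Ldn g r) := by
    intro r hr
    have hrJ : r ∈ JL hg := ⟨hr₁ρ.le.trans hr.1, hr.2⟩
    have hLc : thicken (flower g) (Ldn g r) = level g := (mapsTo_Ldn hg hrJ).1
    set z := (boundaryHomeomorph hg).symm ⟨Ldn g r, hLc⟩ with hzdef
    have hbz : boundaryIncl hg z = Ldn g r := boundaryIncl_symm_apply hg ⟨Ldn g r, hLc⟩
    show boundaryIncl hg (T z) = θ (lam (Ldn g r 1), Ldn g r)
    rcases le_or_gt (Ldn g r 1) (-ε) with hy | hy
    · rw [hfixT z (Or.inr (Or.inl (by rwa [hbz]))), hbz, hlam0 _ (by linarith), h0]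
    · obtain ⟨u, s, hs, hzs⟩ := hN _ (hheadN r hr).1
      have hy0 : Ldn g r 1 ≤ 0 := Ldn_apply_one_nonpos hg ((rho1_pos hg).le.trans hrJ.1)
      have hs' : s = (Ldn g r 1, level g) := by
        rw [← hHσ s hs, ← hHinv u, hzs, pairH_apply, hLc]
      have hsS : s ∈ S := by rw [hs']; exact hparS _ ⟨by linarith, by linarith⟩
      have hsat : boundaryIncl hg z ∈ flowSaturation θ sec S := by
        rw [hbz]; exact mem_flowSaturation_iff.2 ⟨u, s, hsS, hzs⟩
      rw [hTon z hsat (by rw [hbz]; linarith), hbz]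
  have horb : ∀ r ∈ Icc r₁ (rt g 7), ∀ s ∈ Icc (0:ℝ) 1, θ (s * lam (Ldn g r 1), Ldn g r) ∈ sectorZ g := by
    intro r hr s _
    have hrJ : r ∈ JL hg := ⟨hr₁ρ.le.trans hr.1, hr.2⟩
    rcases le_or_gt (Ldn g r 1) (-ε) with hy | hy
    · rw [hlam0 _ (by linarith), mul_zero, h0]; exact mapsTo_Ldn hg hrJ
    · rcases eq_or_lt_of_le hr.2 with hr7 | hr7
      · rw [hr7, Ldn_rt_seven hg]
        exact merC_subset_sectorZ hg (hPmem _)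
      · have hy0 : Ldn g r 1 < 0 := Ldn_apply_one_neg hg (hr₁ρ.trans_le hr.1) hr7
        have hLc : thicken (flower g) (Ldn g r) = level g := (mapsTo_Ldn hg hrJ).1
        have hyε₁ : |Ldn g r 1| ≤ ε₁ :=
          (abs_lt.2 ⟨by linarith, by linarith⟩ : |Ldn g r 1| < ε).le.trans hεε₁
        have hx := ra_lt_orbit_apply_zero hg hθ.continuous h0 hHinv hε₁lt hyε₁ hLc (hheadN r hr).2
          (s * lam (Ldn g r 1))
        refine mem_sectorZ_of_coord hg hεε₂ ?_ hx ?_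
        · show thicken (flower g) _ = level g
          rw [hHc]; exact hLc
        · rw [hHy]; exact ⟨hy, hy0⟩
  have hrest : ∀ r ∈ Icc (rho1 hg) r₁, Ldn g r 1 ≤ -ε ∨ Ldn g r 0 ≤ ra hg := by
    intro r hr
    rcases le_or_gt r (ra hg) with h | h
    · exact Or.inr ((Ldn_apply_zero_le ((rho1_pos hg).le.trans hr.1)).trans h)
    · exact Or.inl ((hη r ⟨h.le, hr.2⟩).trans (by linarith))
  have hℓ : ∀ t, orbLoop θ T₀ hθ.continuous h0 hT₀P t ∈ sectorZ g := fun t =>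
    merC_subset_sectorZ hg (hPmem _)
  have hlam₁ : lam (Ldn g r₁ 1) = 0 := hlam0 _ (by linarith [hη r₁ ⟨hr₁a.le, le_rfl⟩])
  have hlamT₀ : lam 0 = T₀ := (hlam1 0 ⟨le_rfl, by linarith⟩).trans hP0
  -- the twisted `b`-loop and the reading of the orbit loop
  have htw := mk_map_loopR_true hg hr₁ρ hr₁' (restrictZ (onZ hg T) hF) hθ.continuous h0 hlamC.continuous
    hlam₁ hlamT₀ hT₀P hfixS hrest hhead horb hℓ hPS
  have hread' := hread _ hℓ (isParamOn_orbLoop hθ.continuous h0 hT₀P)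
  obtain ⟨e, he, htrue⟩ := mapOfEq_sectorZGenClass_true_of_twist hg _ htopS hPS hgamS hℓ htw hread'
  exact ⟨T, hTnp, e, hF, htopS, he, hfixk,
    mapOfEq_sectorZGenClass_of_forall_eq hg _ htopS hPS hgamS (0, false) hℓa, htrue⟩

/-! ### §9 The meridian twist acts on the marking by the handle transvection -/

/-- **On the marking, the meridian Dehn twist is the handle transvection `b₀ ↦ b₀ a₀ᵉ`, `e = ±1`**:
there is a based self-diffeomorphism `T` of `∂V_{n+2}` (the Dehn twist about the meridian `m₀`) and a
sign `e` with `T_# (ν x) = ν (transvEquiv 0 e x)` for all `x`.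
[cite: FarbMargalit2012, Prop. 3.2, Thm. 4.1, Thm. 8.1] [cite: ZieschangVogtColdewey1980, §3.2, Thm. 5.6.1]
[cite: MagnusKarrassSolitar1966, §3.7 Table 3.1] -/
theorem exists_meridianTwist_marking (n : ℕ) :
    ∃ (T : (𝓡∂ 3).boundary (FlowerHandlebody (show 2 ≤ n + 2 by omega)) ≃ₘ⟮𝓡 2, 𝓡 2⟯
        (𝓡∂ 3).boundary (FlowerHandlebody (show 2 ≤ n + 2 by omega)))
      (hT : T (northPole (show 2 ≤ n + 2 by omega)) = northPole (show 2 ≤ n + 2 by omega)) (e : ℤ),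
      (e = 1 ∨ e = -1) ∧ ∀ x : SurfaceGroup (n + 1 + 1),
        Homeomorph.fundamentalGroupCongr T.toHomeomorph hT (marking n x) =
          marking n (SurfaceGroup.transvEquiv 0 e x) := by
  set hg : 2 ≤ n + 2 := show 2 ≤ n + 2 by omega
  obtain ⟨T, hT, e, hF, htopS, he, hfixk, hfalse, htrue⟩ := exists_meridianTwist_onZ (g := n + 2) hg
  refine ⟨T, hT, e, he, fun x => ?_⟩
  suffices h : ((Homeomorph.fundamentalGroupCongr T.toHomeomorph hT).toMonoidHom.comp (marking n).toMonoidHom) =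
      (marking n).toMonoidHom.comp (SurfaceGroup.transvEquiv 0 e).toMonoidHom by
    exact DFunLike.congr_fun h x
  refine PresentedGroup.ext fun p => ?_
  obtain ⟨k, c⟩ := p
  simp only [MonoidHom.coe_comp, MulEquiv.coe_toMonoidHom, comp_apply, SurfaceGroup.transvEquiv_of]
  apply (fundamentalGroupEquivOfHomeomorph (boundaryHomeomorph hg) (boundaryHomeomorph_northPole hg)).injective
  rw [mapOfEq_boundaryHomeomorph_onZ, marking_of' n k c]
  have hZ : sectorZ (n + 2) ⊆ flowerSurface (n + 2) := sectorZ_subset_flowerSurface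
  by_cases hk0 : k = 0
  · subst hk0
    have hmod : ((0 : Fin (n + 1 + 1)) : ℕ) % (n + 2) = 0 := by simp
    rw [inclHomOfSubset_secSGenClass_of_mod_eq_zero hg hmod _ hZ,
      mapOfEq_inclHomOfSubset_sectorZ hg (onZ hg T) hF (onZ_top hg T hT) htopS hZ]
    cases c
    · rw [hfalse, SurfaceGroup.transvGens_false, SurfaceGroup.a, marking_of' n 0 false,
        inclHomOfSubset_secSGenClass_of_mod_eq_zero hg hmod _ hZ]
    · rw [htrue, map_mul, map_zpow, SurfaceGroup.transvGens_true_self, SurfaceGroup.a, SurfaceGroup.b,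
        map_mul, map_zpow, map_mul, map_zpow, marking_of' n 0 false, marking_of' n 0 true,
        inclHomOfSubset_secSGenClass_of_mod_eq_zero hg hmod _ hZ,
        inclHomOfSubset_secSGenClass_of_mod_eq_zero hg hmod _ hZ]
      rfl
  · have hk1 : 1 ≤ (k : ℕ) := Nat.one_le_iff_ne_zero.2 fun h => hk0 (Fin.ext (by rw [h]; simp))
    have hkg : (k : ℕ) + 1 ≤ n + 2 := by have := k.2; omega
    rw [mapOfEq_inclHomOfSubset_of_forall_eq hg (onZ hg T) (onZ_top hg T hT) _ (hfixk k hk1 hkg)]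
    cases c
    · rw [SurfaceGroup.transvGens_false, SurfaceGroup.a, marking_of' n k false]
    · rw [SurfaceGroup.transvGens_true_of_ne _ _ hk0, SurfaceGroup.b, marking_of' n k true]

end FlowerModel

end Literature.Topology.FourManifolds

end
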